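import Mathlib.Algebra.FreeAbelianGroup.Finsupp
import Mathlib.Analysis.SpecialFunctions.NonIntegrable
import Mathlib.Analysis.SpecialFunctions.Integrals.Basic
import Mathlib.MeasureTheory.Integral.Prod
import Literature.NumberTheory.Transcendental.KZCalculus
import Literature.NumberTheory.Transcendental.KZExpCalculusProofs
import Literature.NumberTheory.Transcendental.SemialgebraicMapsProofs
import Literature.NumberTheory.Transcendental.PeriodConjecture
import HarnessLib
import HarnessLib.Audit

/-!
# The regularised Kontsevich–Zagier calculus on corner charts (`KZreg`)

Definition request `defn-KZreg` of route KontsevichZagierPeriods/Deregularisation (items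
stmt-KontsevichZagierPeriods-4952 RegConservative, -4953 EDSInKZreg, -4954 RegKernel; the typed shell
`DeregularisationShell` of that route's Theses file). Companion of `KZCalculus.lean` (the ordinary
calculus `KZ`), `KZExpCalculus.lean` (design template) and `KZLogCalculus.lean` (the log-MONOMIAL
calculus `KZlog` of route LiouvilleUnfolding — a different object: there the integrands carry
`log` factors and converge; here the integrands are semialgebraic and DIVERGE logarithmically at
coordinate faces, and the integral is Dupont–Panzer–Pym's regularised integral).

## The object

Dupont–Panzer–Pym [DPP] construct, for an oriented manifold with log corners `Σ` equipped with a
regularization `s` (a compatible system of scales = trivialisations of the normal bundles of the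
boundary strata, i.e. `C^∞` tangential base points), a unique linear functional `∫_{(Σ,s)}` on
compactly supported logarithmic top forms which is the ordinary integral whenever that converges
absolutely and satisfies Stokes (Thm.-Def. 1.5, p. 694; Def. 7.6, p. 739; the three laws: change
of variables Cor. 7.9, Fubini Cor. 7.10, Stokes Cor. 7.11, p. 740–741; absolute convergence
Prop. 7.15, p. 742). In a corner chart `[0, a]` with coordinate `r`, pole `dr/r` and scale `λ ∂ᵣ`
at `0` it is the classical regularised integral
`reg ∫₀^a f dr/r = f(0) log(a/λ) + ∫₀^a (f(r) - f(0)) dr/r` (Ex. 7.13, p. 741; = the cut-off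
recipe "discard `log ε`"; Ex. 5.16, p. 726 for regularised limits).

This file fixes the corresponding CALCULUS OF MOVES on `ℚ`-semialgebraic corner data in
Kontsevich–Zagier's top-degree language, entirely inside Mathlib's Lebesgue integral on
`Fin n → ℝ`, for the UNIT scales `∂/∂(1 - tᵢ)` (Deligne's tangential base points `∂/∂t`; the
factor `log(a/λ)` above is then `log 1 = 0`):

* `KZreg.IntegralRep n`: a `ℚ`-semialgebraic `σ ⊆ ℝⁿ`, DIVERGENT COORDINATES `D : Finset (Fin n)`
  with faces `{tᵢ = 1}` bounding `σ` from above, a NUMERATOR `g` (`ℚ`-semialgebraic on `σ` and on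
  every face footprint `faceImage T σ = {t[T:=1] | t ∈ σ}`, `T ⊆ D`), integrand `f = g/∏_{i∈D}(1-tᵢ)`,
  and ADMISSIBILITY: with the thickened face pieces `cyl T σ = {t_T ∈ (0,1)^T, t[T:=1] ∈ faceImage T σ}`
  (the footprint times the unit collar, volume `1`, so that face integrals are `n`-dimensional
  integrals of functions constant in `t_T`), the residues `ρ_T = 1_{cyl T σ} · g(t[T:=1])/Π_{D∖T}`
  and the face remainders `rem S = ∑_{T ⊆ D∖S} (-1)^{|T|} ρ_{S∪T}/Π_T`, every `rem S` is absolutely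
  integrable on `ℝⁿ`. The subtracted integrand is `rem ∅ = ∑_{T⊆D} (-1)^{|T|} ρ_T/Π_T` and the
  REGULARISED VALUE is `value r = ∫ rem ∅` (`= DPP`'s `∫_{(Σ,s)} f dt` in the chart: Ex. 7.13 in each
  divergent coordinate, iterated by Cor. 7.10; Prop. 7.15 is `value_ofKZ`). For `D = ∅` this is
  exactly `KZ.IntegralRep` (`ofKZ`), with `value (ofKZ r) = r.value`.
* `FormalRep := FreeAbelianGroup (Σ n, IntegralRep n)`, `of`, `eval`; `incl : KZ.FormalRep →+ FormalRep`
  (PROVED `incl_injective`, `eval_incl`).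
* MOVES generating `relations` (PROVED sound, `relations_le_ker_eval`):
  (a) `domainAddRel` and (b) `integrandAddRel` — VERBATIM Kontsevich–Zagier's rule (1), for arbitrary
  divergent coordinates on the three representations (so convergent pieces split off with `D = ∅`);
  (c) `changeOfVariablesRel` — a change of variables FIXING THE DIVERGENT COORDINATES, given (with
  Jacobians) on `σ` and on each thickened face piece (DPP Cor. 7.9 for regularisation-preserving
  isomorphisms; unit normal derivative, no anomaly); the `u`-dependent shear
  `(u, x₁, x') ↦ (u, u·x₁, x')` of the route is an instance;
  (d) `newtonLeibnizRel` — `KZ.newtonLeibnizRel` along a NON-divergent last coordinate, imposed on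
  the representation and on each of its face pieces (DPP Cor. 7.11 with a pole-free boundary
  stratum). `map_relations_le : KZ.relations.map incl ≤ relations` (each KZ move is the `D = ∅`
  instance).
* The DE-REGULARISATION `Λ : FormalRep →+ KZ.FormalRep`, `[r] ↦ [mainPiece r]` = the honest KZ
  representation `[σ ∪ ⋃_{T≠∅} cyl T σ, rem ∅]` (stratified finite part by product-collar
  subtraction with zero extension off the domain; prototype Brown–Kreimer's forest subtraction,
  Thm. 60); PROVED `Λ_incl : Λ (incl c) = c` (on the nose) and `eval_Λ : KZ.eval (Λ d) = eval d`.
* Open statements (CONVENTIONS §4, `[status: open]`, hypotheses only): `KernelConjecture`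
  (RegKernel), `Conservative` (RegConservative: `∀ d ∈ relations, Λ d ∈ KZ.relations`). PROVED
  sandwich: `conservative_of_kzKernelConjecture : KZKernelConjecture → Conservative`,
  `kzKernelConjecture_of_conservative : Conservative → KernelConjecture → KZKernelConjecture`
  (= the instance `L := KZreg.FormalRep, ι := incl, Λ` of the route's `DeregularisationShell`,
  which lives under `Summits/` and is therefore not restated here), `Conservative.of_subset`.

## The key theorem: residues are unique, the value depends only on the integrand a.e.

The abstract layer `IsResidueSystem D ρ` (cylindrical, measurable residues `ρ U`, `U ⊆ D`, with all
face remainders integrable) carries the analysis: the CUTOFF LEMMA `IsResidueSystem.integrableOn_prem`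
(every partial remainder is integrable at positive distance from the faces not yet subtracted;
downward induction peeling one face at a time), the TONELLI STEP `ae_eq_zero_of_cylindrical`
(a `{i}`-cylindrical `δ` with `δ/(1-tᵢ)` integrable vanishes a.e., because
`∫₀¹ ds/(1-s) = ∞`), and UNIQUENESS `IsResidueSystem.ae_eq`: two admissible systems with a.e.-equal
`ρ ∅` have a.e.-equal residues on every face (induction on `|D|` through the face systems). Hence
`regValue_congr'`/`regValue_eq_add`: the regularised value depends only on the a.e.-class of the
zero-extended integrand `1_σ f` and is additive — which is why the additivity moves need no
hypothesis on residues and may mix divergent coordinates, and why soundness of (c), (d) reduces to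
Mathlib's Jacobian formula / Fubini + FTC on cutoff regions (`tendsto_setIntegral_cutoff`: the value
is the limit of the integrals over the exhaustion `cutoff D (1/(k+1))`).

## What is deliberately NOT here (v1 scope; the request's items in brackets)

* [1] Rational TANGENTIAL DATA `cᵢ ≠ 1` and the change-of-scale move: all scales are the unit ones
  (the MZV/associator literature's `∂/∂t`); with them the value would acquire the terms
  `∏_{i∈S}(-log cᵢ) · ∫_{face S} rem S` (DPP Ex. 7.13) realised by `Λ` as `∫ dv/v` representations.
* [2] The named fact "`eval = lim_{ε→0} (∫_{t_D ≤ 1-ε} f - P(log ε))`" with a CONSTANT-coefficient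
  polynomial `P` is not vendored (for semialgebraic data it needs power-log asymptotics of
  parametric integrals — Comte–Lion–Rolin / Cluckers–Miller constructible functions); PROVED
  instead is the cutoff expansion with EXPLICIT counterterms `tendsto_cutoffExpansion`:
  `value r = lim_{ε = 1/(k+1) → 0} ∑_{T ⊆ D} (log ε)^{|T|} I_T(ε)`, `I_∅(ε) = ∫_{σ ∩ {t_D ≤ 1-ε}} f` the
  classical cutoff integral and `I_T(ε)` the cutoff integrals of the residues over the faces
  (`faceCutoffIntegral`; collar factorisation `setIntegral_resSys_div_cutoff`).
* [4c] Changes of variables MOVING a divergence face (non-unit normal derivative) and their ANOMALY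
  representations `∫_face Res(f) · log ∂ₙΦ` (DPP §1.1): not moves of this version (the route's shear
  has anomaly `0` and is covered); [4d] regularised Stokes ACROSS a divergent last coordinate
  (boundary term = regularised restriction, DPP §5.3): not a move of this version ("v1 may restrict
  (d) to a non-divergent last coordinate").
* Faces at `tᵢ = 0`, blow-ups of non-normal-crossing divergences (e.g. the corner of the simplex
  `{t₁ < t₂ < 1}` with both `dt/(1-t)` forms): such data are simply not admissible until written in
  product (cubical) corner coordinates — admissibility is a field, never assumed silently.
* No claim that these values exhaust DPP's "logarithmic periods" or equal ordinary periods (DPP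
  §1.2.6 only expect the latter).

## Sanity (route Deregularisation)

The three-move chain `[cube, G/(1-u)] = [cube, u G(u x₁,x')/(1-u)] + [{x₁ > u}, G/(1-u)]` of the
route typechecks as: (c) with `D = {u}`, `Φ_∅ = shear`, `Φ_{u}` = identity on the face piece, then
(a) with pieces `[{y₁ < u}; D = {u}]` and `[{y₁ > u}; D = ∅]`; `Λ` sends `[cube, G/(1-u); {u}]` to
`[cube, (G - G)/(1-u)] = [cube, 0]`, `[cube, uG(ux₁,x')/(1-u); {u}]` to
`[cube, (uG(ux₁,x') - G(x))/(1-u)] = -B_G` and `[{y₁<u}, G/(1-u); {u}]` to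
`[cube, (1_{y₁<u} - 1) G/(1-u)] = -A_G` up to KZ bookkeeping, as the route expects.

## Sources

* C. Dupont, E. Panzer, B. Pym, *Regularized integrals and manifolds with log corners*,
  J. Éc. polytech. Math. 13 (2026) 687–757, doi:10.5802/jep.335 [DupontPanzerPym2026]: §1.1
  (anomaly `log g'(0)`), Thm.-Def. 1.5 (p. 694), Ex. 5.16 (p. 726), Def. 7.1, Def. 7.6, Prop. 7.7,
  Cor. 7.9–7.11, Ex. 7.13–7.14, Prop. 7.15 (pp. 735–743). Read from the materialised text.
* F. Brown, D. Kreimer, *Angles, scales and parametric renormalization*, Lett. Math. Phys. 103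
  (2013) [BrownKreimer2013], Thm. 60 (subtraction of log-divergent parametric forms; context for `Λ`).
* M. Kontsevich, D. Zagier, *Periods* (2001) [KontsevichZagierPeriods2001], §1.2 (the three rules).
* Pattern files: `KZCalculus.lean`, `KZExpCalculus.lean` (and `KZExpCalculusProofs.lean`, whose Fubini
  lemma `KZexp.integral_eq_integral_integral_snoc` is reused), `KZLogCalculus.lean`.

## Design notes

* Faces are `{tᵢ = 1}` approached from below through the unit collar `tᵢ ∈ (0,1)` (the request's
  convention `tᵢ → 1⁻`); the thickening by the unit cube keeps every face integral in dimension `n`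
  (no `Fin (n - |T|)` reindexing) and encodes the unit scale (`reg ∫₀¹ ds/(1-s) = 0`).
* The numerator `g` is ONE function on `ℝⁿ` whose values on the footprints are the residues; the
  integrability field forces them to be the correct limits whenever limits exist (uniqueness of
  residues), so no limits and no junk values enter the definitions.
* `mainIntegrand` drops the integrand on `outer = (⋃_{T≠∅} cyl T σ) ∖ σ` by an indicator of the
  complement rather than zero-extending `f` by `1_σ`, so that `mainPiece (ofKZ r) = r` and
  `Λ ∘ incl = id` hold literally.
* Coefficients `ℤ`, data `ℚ`-semialgebraic on `Fin n → ℝ`, as in `KZ`; Tarski–Seidenberg enters only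
  through the proved `…_holds` closure lemmas of `SemialgebraicMapsProofs.lean`.
-/

noncomputable section

open MeasureTheory Set Filter MvPolynomial
open scoped BigOperators Topology ENNReal
open Literature.ModelTheory.ExponentialFields (IsSemialgebraic isSemialgebraic_setOf_eval_pos
  isSemialgebraic_setOf_eval_lt isSemialgebraic_univ)

namespace Literature.NumberTheory.Transcendental

namespace KZreg

variable {n : ℕ}

/-! ### Corner-chart combinatorics: divergence factors, face maps, thickened faces -/

/-- The product of divergence factors `Π_T(t) = ∏_{i ∈ T} (1 - tᵢ)` attached to a finite set `T` of
coordinates (the faces are the hyperplanes `tᵢ = 1`). [folklore] -/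
def divProd (T : Finset (Fin n)) (t : Fin n → ℝ) : ℝ := ∏ i ∈ T, (1 - t i)

/-- The face map `t ↦ t[T := 1]`: sets the coordinates in `T` to `1`. [folklore] -/
def faceMap (T : Finset (Fin n)) (t : Fin n → ℝ) : Fin n → ℝ := fun i => if i ∈ T then 1 else t i

/-- The footprint of `σ` on the face `{t_T = 1}`: the image `faceMap T '' σ`. [folklore] -/
def faceImage (T : Finset (Fin n)) (σ : Set (Fin n → ℝ)) : Set (Fin n → ℝ) := faceMap T '' σ

/-- The open unit thickening condition in the coordinates of `T`: `tᵢ ∈ (0, 1)` for `i ∈ T`.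
[folklore] -/
def thick (T : Finset (Fin n)) : Set (Fin n → ℝ) := {t | ∀ i ∈ T, t i ∈ Ioo (0 : ℝ) 1}

/-- The THICKENED FACE PIECE of `σ` along `T`: the points `t` with `t_T ∈ (0,1)^T` whose face point
`t[T := 1]` lies in the footprint `faceImage T σ`. It is the footprint thickened by the unit cube in
the `T`-directions (volume `1`), so that `(n - |T|)`-dimensional integrals over the face are
`n`-dimensional integrals over `cyl T σ` of functions constant in `t_T`. [folklore] -/
def cyl (T : Finset (Fin n)) (σ : Set (Fin n → ℝ)) : Set (Fin n → ℝ) :=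
  thick T ∩ faceMap T ⁻¹' faceImage T σ

/-- The empty divergence factor is `1`. [folklore] -/
@[simp] theorem divProd_empty (t : Fin n → ℝ) : divProd ∅ t = 1 := by simp [divProd]

/-- Peeling one factor off a divergence factor. [folklore] -/
theorem divProd_insert {T : Finset (Fin n)} {x : Fin n} (hx : x ∉ T) (t : Fin n → ℝ) :
    divProd (insert x T) t = (1 - t x) * divProd T t := by
  simp [divProd, Finset.prod_insert hx]

/-- Divergence factors are multiplicative on disjoint unions. [folklore] -/
theorem divProd_union {T U : Finset (Fin n)} (h : Disjoint T U) (t : Fin n → ℝ) :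
    divProd (T ∪ U) t = divProd T t * divProd U t := by
  simp [divProd, Finset.prod_union h]

/-- A divergence factor does not vanish off its faces. [folklore] -/
theorem divProd_ne_zero {T : Finset (Fin n)} {t : Fin n → ℝ} (h : ∀ i ∈ T, t i ≠ 1) :
    divProd T t ≠ 0 := by
  simp only [divProd]
  exact Finset.prod_ne_zero_iff.2 fun i hi => sub_ne_zero.2 (Ne.symm (h i hi))

/-- The empty face map is the identity. [folklore] -/
@[simp] theorem faceMap_empty : faceMap (∅ : Finset (Fin n)) = id := by
  funext t; ext i; simp [faceMap]

/-- The face map sets the coordinates of `T` to `1`. [folklore] -/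
theorem faceMap_apply_of_mem {T : Finset (Fin n)} {i : Fin n} (hi : i ∈ T) (t : Fin n → ℝ) :
    faceMap T t i = 1 := by simp [faceMap, hi]

/-- The face map keeps the coordinates outside `T`. [folklore] -/
theorem faceMap_apply_of_not_mem {T : Finset (Fin n)} {i : Fin n} (hi : i ∉ T) (t : Fin n → ℝ) :
    faceMap T t i = t i := by simp [faceMap, hi]

/-- Face maps compose to the face map of the union. [folklore] -/
theorem faceMap_faceMap (T U : Finset (Fin n)) (t : Fin n → ℝ) :
    faceMap T (faceMap U t) = faceMap (T ∪ U) t := by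
  ext i; by_cases hT : i ∈ T <;> by_cases hU : i ∈ U <;> simp [faceMap, hT, hU]

/-- Face maps are idempotent. [folklore] -/
@[simp] theorem faceMap_idem (T : Finset (Fin n)) (t : Fin n → ℝ) :
    faceMap T (faceMap T t) = faceMap T t := by
  rw [faceMap_faceMap, Finset.union_idempotent]

/-- The face map forgets updates of coordinates in `T`. [folklore] -/
theorem faceMap_update_of_mem {T : Finset (Fin n)} {i : Fin n} (hi : i ∈ T) (t : Fin n → ℝ)
    (s : ℝ) : faceMap T (Function.update t i s) = faceMap T t := by
  ext j
  by_cases hj : j ∈ T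
  · simp [faceMap, hj]
  · have : j ≠ i := fun h => hj (h ▸ hi)
    simp [faceMap, hj, this]

/-- A divergence factor only sees coordinates outside a disjoint face. [folklore] -/
theorem divProd_faceMap_of_disjoint {T U : Finset (Fin n)} (h : Disjoint T U) (t : Fin n → ℝ) :
    divProd T (faceMap U t) = divProd T t := by
  simp only [divProd]
  refine Finset.prod_congr rfl fun i hi => ?_
  rw [faceMap_apply_of_not_mem (Finset.disjoint_left.1 h hi)]

/-- A divergence factor does not see updates of coordinates outside it. [folklore] -/
theorem divProd_update_of_not_mem {T : Finset (Fin n)} {i : Fin n} (hi : i ∉ T) (t : Fin n → ℝ)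
    (s : ℝ) : divProd T (Function.update t i s) = divProd T t := by
  simp only [divProd]
  refine Finset.prod_congr rfl fun j hj => ?_
  have : j ≠ i := fun h => hi (h ▸ hj)
  simp [this]

/-- The empty footprint is the set itself. [folklore] -/
@[simp] theorem faceImage_empty (σ : Set (Fin n → ℝ)) : faceImage ∅ σ = σ := by
  simp [faceImage]

/-- The empty thickening condition is vacuous. [folklore] -/
@[simp] theorem thick_empty : thick (∅ : Finset (Fin n)) = univ := by
  simp [thick]

/-- The thickened piece along the empty face is the set itself. [folklore] -/
@[simp] theorem cyl_empty (σ : Set (Fin n → ℝ)) : cyl ∅ σ = σ := by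
  simp [cyl]

/-- Membership in a thickened face piece. [folklore] -/
theorem mem_cyl_iff {T : Finset (Fin n)} {σ : Set (Fin n → ℝ)} {t : Fin n → ℝ} :
    t ∈ cyl T σ ↔ (∀ i ∈ T, t i ∈ Ioo (0 : ℝ) 1) ∧ ∃ s ∈ σ, faceMap T s = faceMap T t := by
  simp [cyl, thick, faceImage]

/-- Face points of `σ` lie in the footprint. [folklore] -/
theorem faceMap_mem_faceImage {T : Finset (Fin n)} {σ : Set (Fin n → ℝ)} {t : Fin n → ℝ}
    (ht : t ∈ σ) : faceMap T t ∈ faceImage T σ := ⟨t, ht, rfl⟩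

/-! ### Residue systems and their remainders (the abstract subtraction scheme)

A *residue system* relative to a finite set `D` of divergent coordinates is a family
`ρ : Finset (Fin n) → (ℝⁿ → ℝ)`; `ρ ∅` is the (zero-extended, possibly non-integrable) function to
be regularised and `ρ U` (`U ⊆ D`) is its residue along the thickened face `U`. The REMAINDER of the
face `S` is `rem D ρ S = ∑_{T ⊆ D \ S} (-1)^{|T|} ρ (S ∪ T) / Π_T`; the system is admissible when
every remainder is integrable, and the regularised value is `∫ rem D ρ ∅`. -/

/-- A function is `U`-CYLINDRICAL if it is supported in the open unit thickening `{t_U ∈ (0,1)^U}`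
and is invariant under moving any coordinate `i ∈ U` inside `(0, 1)`. [folklore] -/
def IsCylindrical (U : Finset (Fin n)) (ψ : (Fin n → ℝ) → ℝ) : Prop :=
  (∀ t, ψ t ≠ 0 → ∀ i ∈ U, t i ∈ Ioo (0 : ℝ) 1) ∧
    ∀ t, ∀ i ∈ U, ∀ s ∈ Ioo (0 : ℝ) 1, t i ∈ Ioo (0 : ℝ) 1 → ψ (Function.update t i s) = ψ t

/-- The remainder of the face `S` of a residue system `ρ` relative to `D`:
`rem D ρ S t = ∑_{T ⊆ D \ S} (-1)^{|T|} ρ (S ∪ T) t / Π_T(t)`. For `S = ∅` this is the SUBTRACTED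
INTEGRAND `∑_{T ⊆ D} (-1)^{|T|} ρ_T / Π_T`. [folklore] -/
def rem (D : Finset (Fin n)) (ρ : Finset (Fin n) → (Fin n → ℝ) → ℝ) (S : Finset (Fin n))
    (t : Fin n → ℝ) : ℝ :=
  ∑ T ∈ (D \ S).powerset, (-1 : ℝ) ^ T.card * ρ (S ∪ T) t / divProd T t

/-- ADMISSIBLE residue systems relative to `D`: every residue `ρ U` (`U ⊆ D`) is `U`-cylindrical and
Borel measurable, and every face remainder `rem D ρ S` (`S ⊆ D`) is Lebesgue integrable on `ℝⁿ`.
[folklore] -/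
structure IsResidueSystem (D : Finset (Fin n)) (ρ : Finset (Fin n) → (Fin n → ℝ) → ℝ) : Prop where
  cylindrical : ∀ U, U ⊆ D → IsCylindrical U (ρ U)
  measurable : ∀ U, U ⊆ D → Measurable (ρ U)
  integrable_rem : ∀ S, S ⊆ D → Integrable (rem D ρ S)

/-- The regularised value of an admissible residue system: the integral of the subtracted
integrand `rem D ρ ∅`. [folklore] -/
def regValue (D : Finset (Fin n)) (ρ : Finset (Fin n) → (Fin n → ℝ) → ℝ) : ℝ := ∫ t, rem D ρ ∅ t

/-- Without divergent coordinates the remainder is the function itself. [folklore] -/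
@[simp] theorem rem_empty_empty (ρ : Finset (Fin n) → (Fin n → ℝ) → ℝ) :
    rem ∅ ρ ∅ = ρ ∅ := by
  funext t; simp [rem]

/-- Remainders are additive in the residue system. [folklore] -/
theorem rem_add (D : Finset (Fin n)) (ρ ρ' : Finset (Fin n) → (Fin n → ℝ) → ℝ)
    (S : Finset (Fin n)) : rem D (ρ + ρ') S = rem D ρ S + rem D ρ' S := by
  funext t
  simp only [rem, Pi.add_apply, ← Finset.sum_add_distrib]
  refine Finset.sum_congr rfl fun T _ => ?_
  ring

/-- Remainders of the negated system. [folklore] -/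
theorem rem_neg (D : Finset (Fin n)) (ρ : Finset (Fin n) → (Fin n → ℝ) → ℝ) (S : Finset (Fin n)) :
    rem D (-ρ) S = -rem D ρ S := by
  funext t
  simp only [rem, Pi.neg_apply, ← Finset.sum_neg_distrib]
  refine Finset.sum_congr rfl fun T _ => ?_
  ring

/-- Remainders of a difference of systems. [folklore] -/
theorem rem_sub (D : Finset (Fin n)) (ρ ρ' : Finset (Fin n) → (Fin n → ℝ) → ℝ)
    (S : Finset (Fin n)) : rem D (ρ - ρ') S = rem D ρ S - rem D ρ' S := by
  rw [sub_eq_add_neg, rem_add, rem_neg, ← sub_eq_add_neg]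

namespace IsCylindrical

variable {U V : Finset (Fin n)} {ψ ψ' : (Fin n → ℝ) → ℝ}

/-- The zero function is cylindrical. [folklore] -/
theorem zero (U : Finset (Fin n)) : IsCylindrical U (0 : (Fin n → ℝ) → ℝ) :=
  ⟨fun _ h => (h rfl).elim, fun _ _ _ _ _ _ => rfl⟩

/-- Cylindricity is monotone in the set of coordinates. [folklore] -/
theorem mono (h : IsCylindrical V ψ) (hUV : U ⊆ V) : IsCylindrical U ψ :=
  ⟨fun t ht i hi => h.1 t ht i (hUV hi), fun t i hi s hs hti => h.2 t i (hUV hi) s hs hti⟩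

/-- Sums of cylindrical functions are cylindrical. [folklore] -/
theorem add (h : IsCylindrical U ψ) (h' : IsCylindrical U ψ') : IsCylindrical U (ψ + ψ') := by
  refine ⟨fun t ht i hi => ?_, fun t i hi s hs hti => by simp [h.2 t i hi s hs hti, h'.2 t i hi s hs hti]⟩
  by_cases h0 : ψ t = 0
  · have : ψ' t ≠ 0 := by simpa [h0] using ht
    exact h'.1 t this i hi
  · exact h.1 t h0 i hi

/-- Negatives of cylindrical functions are cylindrical. [folklore] -/
theorem neg (h : IsCylindrical U ψ) : IsCylindrical U (-ψ) :=
  ⟨fun t ht i hi => h.1 t (by simpa using ht) i hi, fun t i hi s hs hti => by simp [h.2 t i hi s hs hti]⟩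

/-- Differences of cylindrical functions are cylindrical. [folklore] -/
theorem sub (h : IsCylindrical U ψ) (h' : IsCylindrical U ψ') : IsCylindrical U (ψ - ψ') := by
  simpa [sub_eq_add_neg] using h.add h'.neg

/-- A `U`-cylindrical function vanishes unless `t_U ∈ (0,1)^U`. [folklore] -/
theorem eq_zero_of_not_mem (h : IsCylindrical U ψ) {t : Fin n → ℝ} {i : Fin n} (hi : i ∈ U)
    (ht : t i ∉ Ioo (0 : ℝ) 1) : ψ t = 0 := by
  by_contra h0
  exact ht (h.1 t h0 i hi)

/-- Along a coordinate `i ∈ U`, a `U`-cylindrical function is `1_{(0,1)}(s)` times its value at the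
reference height `1/2`. [folklore] -/
theorem apply_update (h : IsCylindrical U ψ) {i : Fin n} (hi : i ∈ U) (t : Fin n → ℝ) (s : ℝ) :
    ψ (Function.update t i s) =
      (Ioo (0 : ℝ) 1).indicator (fun _ => ψ (Function.update t i (1 / 2))) s := by
  by_cases hs : s ∈ Ioo (0 : ℝ) 1
  · rw [indicator_of_mem hs]
    have h12 : (1 / 2 : ℝ) ∈ Ioo (0 : ℝ) 1 := by norm_num
    have := h.2 (Function.update t i (1 / 2)) i hi s hs (by simpa using h12)
    simpa using this
  · rw [indicator_of_notMem hs]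
    exact h.eq_zero_of_not_mem hi (by simpa using hs)

end IsCylindrical

namespace IsResidueSystem

variable {D D' : Finset (Fin n)} {ρ ρ' : Finset (Fin n) → (Fin n → ℝ) → ℝ}

/-- Sums of admissible residue systems are admissible. [folklore] -/
theorem add (h : IsResidueSystem D ρ) (h' : IsResidueSystem D ρ') : IsResidueSystem D (ρ + ρ') where
  cylindrical U hU := (h.cylindrical U hU).add (h'.cylindrical U hU)
  measurable U hU := (h.measurable U hU).add (h'.measurable U hU)
  integrable_rem S hS := by
    rw [rem_add]; exact (h.integrable_rem S hS).add (h'.integrable_rem S hS)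

/-- Negatives of admissible residue systems are admissible. [folklore] -/
theorem neg (h : IsResidueSystem D ρ) : IsResidueSystem D (-ρ) where
  cylindrical U hU := (h.cylindrical U hU).neg
  measurable U hU := (h.measurable U hU).neg
  integrable_rem S hS := by rw [rem_neg]; exact (h.integrable_rem S hS).neg

/-- Differences of admissible residue systems are admissible. [folklore] -/
theorem sub (h : IsResidueSystem D ρ) (h' : IsResidueSystem D ρ') : IsResidueSystem D (ρ - ρ') := by
  simpa [sub_eq_add_neg] using h.add h'.neg

/-- Extension by zero of a residue system to a larger set of divergent coordinates. [folklore] -/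
def extendZero (D : Finset (Fin n)) (ρ : Finset (Fin n) → (Fin n → ℝ) → ℝ) :
    Finset (Fin n) → (Fin n → ℝ) → ℝ := fun U => if U ⊆ D then ρ U else 0

/-- Remainders are unchanged by extension by zero. [folklore] -/
theorem rem_extendZero (hDD' : D ⊆ D') (S : Finset (Fin n)) (hS : S ⊆ D) :
    rem D' (extendZero D ρ) S = rem D ρ S := by
  funext t
  simp only [rem, extendZero]
  have hsub : (D \ S).powerset ⊆ (D' \ S).powerset :=
    Finset.powerset_mono.2 (Finset.sdiff_subset_sdiff hDD' le_rfl)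
  rw [← Finset.sum_subset hsub]
  · refine Finset.sum_congr rfl fun T hT => ?_
    have : S ∪ T ⊆ D := Finset.union_subset hS
      ((Finset.mem_powerset.1 hT).trans Finset.sdiff_subset)
    simp [this]
  · intro T hT hT'
    have : ¬ S ∪ T ⊆ D := by
      intro h
      apply hT'
      rw [Finset.mem_powerset] at hT ⊢
      intro i hi
      have hiD : i ∈ D := h (Finset.mem_union_right _ hi)
      have hiS : i ∉ S := (Finset.mem_sdiff.1 (hT hi)).2
      exact Finset.mem_sdiff.2 ⟨hiD, hiS⟩
    simp [this]

/-- Remainders of faces outside the original coordinates vanish after extension by zero. [folklore] -/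
theorem rem_extendZero_of_not_subset (S : Finset (Fin n)) (hS : ¬ S ⊆ D) :
    rem D' (extendZero D ρ) S = 0 := by
  funext t
  simp only [rem, extendZero, Pi.zero_apply]
  refine Finset.sum_eq_zero fun T _ => ?_
  have : ¬ S ∪ T ⊆ D := fun h => hS (Finset.union_subset_left h)
  simp [this]

/-- Extension by zero does not change the original residues. [folklore] -/
theorem extendZero_of_subset {U : Finset (Fin n)} (hU : U ⊆ D) : extendZero D ρ U = ρ U := by
  simp [extendZero, hU]

/-- Extension by zero preserves admissibility. [folklore] -/
theorem extend (h : IsResidueSystem D ρ) (hDD' : D ⊆ D') : IsResidueSystem D' (extendZero D ρ) where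
  cylindrical U _ := by
    by_cases hU : U ⊆ D
    · rw [extendZero_of_subset hU]; exact h.cylindrical U hU
    · simp only [extendZero, hU, if_false]; exact IsCylindrical.zero U
  measurable U _ := by
    by_cases hU : U ⊆ D
    · rw [extendZero_of_subset hU]; exact h.measurable U hU
    · simp only [extendZero, hU, if_false]; exact measurable_zero
  integrable_rem S _ := by
    by_cases hS : S ⊆ D
    · rw [rem_extendZero hDD' S hS]; exact h.integrable_rem S hS
    · rw [rem_extendZero_of_not_subset S hS]; exact integrable_zero _ _ _

/-- The regularised value is unchanged by extension by zero. [folklore] -/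
theorem regValue_extendZero (hDD' : D ⊆ D') :
    regValue D' (extendZero D ρ) = regValue D ρ := by
  simp [regValue, rem_extendZero hDD' ∅ (Finset.empty_subset D)]

end IsResidueSystem

/-! ### Partial remainders and the cutoff lemma -/

/-- The partial remainder of the face `S` subtracting only the faces in `W`:
`prem ρ S W t = ∑_{U ⊆ W} (-1)^{|U|} ρ (S ∪ U) t / Π_U(t)`; `rem D ρ S = prem ρ S (D \ S)`.
[folklore] -/
def prem (ρ : Finset (Fin n) → (Fin n → ℝ) → ℝ) (S W : Finset (Fin n)) (t : Fin n → ℝ) : ℝ :=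
  ∑ U ∈ W.powerset, (-1 : ℝ) ^ U.card * ρ (S ∪ U) t / divProd U t

/-- The full remainder is the partial remainder subtracting all remaining faces. [folklore] -/
theorem rem_eq_prem (D : Finset (Fin n)) (ρ : Finset (Fin n) → (Fin n → ℝ) → ℝ)
    (S : Finset (Fin n)) : rem D ρ S = prem ρ S (D \ S) := rfl

/-- Subtracting no face gives the residue back. [folklore] -/
@[simp] theorem prem_empty (ρ : Finset (Fin n) → (Fin n → ℝ) → ℝ) (S : Finset (Fin n)) :
    prem ρ S ∅ = ρ S := by
  funext t; simp [prem]

/-- Peeling one subtracted face off a partial remainder. [folklore] -/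
theorem prem_insert (ρ : Finset (Fin n) → (Fin n → ℝ) → ℝ) {S W : Finset (Fin n)} {x : Fin n}
    (hx : x ∉ W) (t : Fin n → ℝ) :
    prem ρ S (insert x W) t = prem ρ S W t - (1 - t x)⁻¹ * prem ρ (insert x S) W t := by
  simp only [prem]
  rw [Finset.sum_powerset_insert hx, sub_eq_add_neg, Finset.mul_sum, ← Finset.sum_neg_distrib]
  congr 1
  refine Finset.sum_congr rfl fun U hU => ?_
  have hxU : x ∉ U := fun h => hx (Finset.mem_powerset.1 hU h)
  rw [Finset.card_insert_of_notMem hxU, pow_succ, Finset.union_insert, Finset.insert_union,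
    divProd_insert hxU, div_mul_eq_div_div_swap]
  ring

/-- The two-sided cutoff region at distance `ε` from the faces in `X`:
`{t | ∀ j ∈ X, ε ≤ |1 - t j|}`. [folklore] -/
def cutoff (X : Finset (Fin n)) (ε : ℝ) : Set (Fin n → ℝ) := {t | ∀ j ∈ X, ε ≤ |1 - t j|}

/-- The cutoff region as a finite intersection of closed half-spaces-like sets. [folklore] -/
theorem cutoff_eq_iInter (X : Finset (Fin n)) (ε : ℝ) :
    cutoff X ε = ⋂ j ∈ X, {t : Fin n → ℝ | ε ≤ |1 - t j|} := by
  ext t; simp [cutoff]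

/-- Cutoff regions are closed. [folklore] -/
theorem isClosed_cutoff (X : Finset (Fin n)) (ε : ℝ) : IsClosed (cutoff X ε) := by
  rw [cutoff_eq_iInter]
  refine isClosed_biInter fun j _ => ?_
  exact isClosed_le continuous_const
    (continuous_abs.comp (continuous_const.sub (continuous_apply j)))

/-- Cutoff regions are measurable. [folklore] -/
theorem measurableSet_cutoff (X : Finset (Fin n)) (ε : ℝ) : MeasurableSet (cutoff X ε) :=
  (isClosed_cutoff X ε).measurableSet

/-- Cutoff regions shrink when more faces are cut off. [folklore] -/
theorem cutoff_mono {X Y : Finset (Fin n)} (h : X ⊆ Y) (ε : ℝ) : cutoff Y ε ⊆ cutoff X ε :=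
  fun _ ht j hj => ht j (h hj)

/-- On a cutoff region the reciprocal distance to a cut-off face is bounded. [folklore] -/
theorem abs_inv_one_sub_le_of_mem_cutoff {X : Finset (Fin n)} {ε : ℝ} (hε : 0 < ε) {j : Fin n}
    (hj : j ∈ X) {t : Fin n → ℝ} (ht : t ∈ cutoff X ε) : |(1 - t j)⁻¹| ≤ ε⁻¹ := by
  rw [abs_inv]
  exact inv_anti₀ hε (ht j hj)

/-- Divergence factors are measurable. [folklore] -/
theorem measurable_divProd (T : Finset (Fin n)) : Measurable (divProd T) := by
  refine Finset.measurable_prod _ fun i _ => ?_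
  exact measurable_const.sub (measurable_pi_apply i)

/-- Reciprocal face distances are measurable. [folklore] -/
theorem measurable_inv_one_sub (j : Fin n) : Measurable fun t : Fin n → ℝ => (1 - t j)⁻¹ :=
  (measurable_const.sub (measurable_pi_apply j)).inv

namespace IsResidueSystem

variable {D : Finset (Fin n)} {ρ ρ' : Finset (Fin n) → (Fin n → ℝ) → ℝ}

/-- Partial remainders of an admissible system are measurable. [folklore] -/
theorem measurable_prem (h : IsResidueSystem D ρ) {S W : Finset (Fin n)} (hS : S ⊆ D)
    (hW : W ⊆ D \ S) : Measurable (prem ρ S W) := by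
  unfold prem
  refine Finset.measurable_sum _ fun U hU => ?_
  have hSU : S ∪ U ⊆ D := Finset.union_subset hS
    (((Finset.mem_powerset.1 hU).trans hW).trans Finset.sdiff_subset)
  exact (measurable_const.mul (h.measurable _ hSU)).div (measurable_divProd U)

/-- **Cutoff lemma.** For an admissible residue system, the partial remainder of the face `S`
subtracting only the faces `W ⊆ D \ S` is integrable on the cutoff region at any distance `ε > 0`
from the remaining faces `(D \ S) \ W` (downward induction: peel one face at a time with
`prem_insert`, the peeled term carrying the bounded factor `(1 - t x)⁻¹`). In particular
(`W = ∅`) every residue `ρ S` is integrable away from its own divergence faces. [folklore] -/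
theorem integrableOn_prem (h : IsResidueSystem D ρ) {ε : ℝ} (hε : 0 < ε) :
    ∀ (k : ℕ) (S W : Finset (Fin n)), S ⊆ D → W ⊆ D \ S → ((D \ S) \ W).card = k →
      IntegrableOn (prem ρ S W) (cutoff ((D \ S) \ W) ε) := by
  intro k
  induction k with
  | zero =>
    intro S W hS hW hk
    have hW' : W = D \ S := by
      refine Finset.Subset.antisymm hW fun j hj => ?_
      by_contra hjW
      have : j ∈ (D \ S) \ W := Finset.mem_sdiff.2 ⟨hj, hjW⟩
      rw [Finset.card_eq_zero.1 hk] at this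
      simp at this
    subst hW'
    exact (h.integrable_rem S hS).integrableOn
  | succ k ih =>
    intro S W hS hW hk
    obtain ⟨x, hx⟩ : ((D \ S) \ W).Nonempty := Finset.card_pos.1 (by omega)
    have hxDS : x ∈ D \ S := (Finset.mem_sdiff.1 hx).1
    have hxW : x ∉ W := (Finset.mem_sdiff.1 hx).2
    have hxD : x ∈ D := (Finset.mem_sdiff.1 hxDS).1
    have hxS : x ∉ S := (Finset.mem_sdiff.1 hxDS).2
    -- first recursive call: subtract `x` as well
    have h1 : IntegrableOn (prem ρ S (insert x W)) (cutoff ((D \ S) \ W) ε) := by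
      have hW1 : insert x W ⊆ D \ S := Finset.insert_subset hxDS hW
      have hk1 : ((D \ S) \ insert x W).card = k := by
        have : (D \ S) \ insert x W = ((D \ S) \ W).erase x := by
          ext j; simp [Finset.mem_sdiff, Finset.mem_erase]; tauto
        rw [this, Finset.card_erase_of_mem hx]; omega
      refine (ih S (insert x W) hS hW1 hk1).mono_set (cutoff_mono ?_ ε)
      exact Finset.sdiff_subset_sdiff le_rfl (Finset.subset_insert _ _)
    -- second recursive call: move `x` into the face
    have h2 : IntegrableOn (prem ρ (insert x S) W) (cutoff ((D \ S) \ W) ε) := by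
      have hS2 : insert x S ⊆ D := Finset.insert_subset hxD hS
      have hW2 : W ⊆ D \ insert x S := by
        intro j hj
        have hj' := Finset.mem_sdiff.1 (hW hj)
        refine Finset.mem_sdiff.2 ⟨hj'.1, ?_⟩
        rw [Finset.mem_insert]
        rintro (rfl | h')
        · exact hxW hj
        · exact hj'.2 h'
      have hset : (D \ insert x S) \ W = ((D \ S) \ W).erase x := by
        ext j; simp [Finset.mem_sdiff, Finset.mem_erase]; tauto
      have hk2 : ((D \ insert x S) \ W).card = k := by
        rw [hset, Finset.card_erase_of_mem hx]; omega
      have := ih (insert x S) W hS2 hW2 hk2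
      rw [hset] at this
      exact this.mono_set (cutoff_mono (Finset.erase_subset _ _) ε)
    have h3 : IntegrableOn (fun t => (1 - t x)⁻¹ * prem ρ (insert x S) W t)
        (cutoff ((D \ S) \ W) ε) := by
      refine Integrable.bdd_mul (c := ε⁻¹) h2 (measurable_inv_one_sub x).aestronglyMeasurable
        (ae_restrict_of_forall_mem (measurableSet_cutoff _ _) fun t ht => ?_)
      rw [Real.norm_eq_abs]
      exact abs_inv_one_sub_le_of_mem_cutoff hε hx ht
    have heq : prem ρ S W = fun t => prem ρ S (insert x W) t + (1 - t x)⁻¹ * prem ρ (insert x S) W t := by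
      funext t; rw [prem_insert ρ hxW]; ring
    rw [heq]
    exact h1.add h3

/-- Every residue of an admissible system is integrable away from its divergence faces.
[folklore] -/
theorem integrableOn_cutoff (h : IsResidueSystem D ρ) {S : Finset (Fin n)} (hS : S ⊆ D) {ε : ℝ}
    (hε : 0 < ε) : IntegrableOn (ρ S) (cutoff (D \ S) ε) := by
  simpa using h.integrableOn_prem hε ((D \ S) \ ∅).card S ∅ hS (Finset.empty_subset _) rfl

end IsResidueSystem

/-! ### The Tonelli step: a cylindrical residue divided by its divergence factor is never integrable -/

/-- `∫⁻_{(0,1)} ‖(1 - s)⁻¹‖ₑ ds = ∞` (the divergence `reg ∫₀¹ ds/(1-s)` subtracts).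
[folklore] -/
theorem lintegral_enorm_inv_one_sub_Ioo : ∫⁻ s in Ioo (0 : ℝ) 1, ‖(1 - s)⁻¹‖ₑ = ∞ := by
  by_contra hne
  have hmeas : Measurable fun s : ℝ => (1 - s)⁻¹ := (measurable_const.sub measurable_id).inv
  have hint : IntegrableOn (fun s : ℝ => (1 - s)⁻¹) (Ioo 0 1) :=
    ⟨hmeas.aestronglyMeasurable, lt_top_iff_ne_top.2 hne⟩
  have hint' : IntegrableOn (fun s : ℝ => (s - 1)⁻¹) (Ioo 0 1) := by
    have : (fun s : ℝ => (s - 1)⁻¹) = fun s => -(1 - s)⁻¹ := by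
      funext s; rw [← neg_sub, inv_neg]
    rw [this]
    exact hint.neg
  have hII : IntervalIntegrable (fun s : ℝ => (s - 1)⁻¹) volume 0 1 :=
    (intervalIntegrable_iff_integrableOn_Ioo_of_le zero_le_one).2 hint'
  rcases intervalIntegrable_sub_inv_iff.1 hII with h | h
  · exact zero_ne_one h
  · exact h (by simp)

/-- **Tonelli step.** Let `δ` be `{i}`-cylindrical and measurable, `A` a measurable set not
constraining the coordinate `i`, and suppose `(1 - tᵢ)⁻¹ δ(t)` is integrable on `A`. Then `δ = 0`
a.e. on `A`: along each fibre in the direction `i` the function is `δ(ref) · 1_{(0,1)}(s)/(1-s)`,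
whose integral is infinite unless `δ(ref) = 0`. [folklore] -/
theorem ae_eq_zero_of_cylindrical {m : ℕ} (i : Fin (m + 1)) {δ : (Fin (m + 1) → ℝ) → ℝ}
    (hδ : IsCylindrical {i} δ) (hδm : Measurable δ) {A : Set (Fin (m + 1) → ℝ)}
    (hA : MeasurableSet A) (hAi : ∀ t s, t ∈ A → Function.update t i s ∈ A)
    (hint : IntegrableOn (fun t => (1 - t i)⁻¹ * δ t) A) :
    ∀ᵐ t ∂volume, t ∈ A → δ t = 0 := by
  set e : (Fin (m + 1) → ℝ) ≃ᵐ ℝ × (Fin m → ℝ) :=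
    MeasurableEquiv.piFinSuccAbove (fun _ => ℝ) i with he_def
  have he : MeasurePreserving e volume volume := volume_preserving_piFinSuccAbove (fun _ => ℝ) i
  have he_symm : ∀ p : ℝ × (Fin m → ℝ), e.symm p = Fin.insertNth i p.1 p.2 := fun p => by
    simp [he_def, MeasurableEquiv.piFinSuccAbove_symm_apply, Fin.insertNthEquiv]
  have he_upd : ∀ (s s' : ℝ) (y : Fin m → ℝ), e.symm (s', y) = Function.update (e.symm (s, y)) i s' := by
    intro s s' y; rw [he_symm, he_symm]; simp
  have he_apply : ∀ (s : ℝ) (y : Fin m → ℝ), e.symm (s, y) i = s := by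
    intro s y; rw [he_symm]; simp
  have hi : i ∈ ({i} : Finset (Fin (m + 1))) := Finset.mem_singleton_self i
  -- reference section and the pointwise product structure
  set F : (Fin (m + 1) → ℝ) → ℝ≥0∞ := A.indicator fun t => ‖(1 - t i)⁻¹ * δ t‖ₑ with hF_def
  set c : (Fin m → ℝ) → ℝ≥0∞ := fun y => A.indicator (fun t => ‖δ t‖ₑ) (e.symm (1 / 2, y))
    with hc_def
  have hF_meas : Measurable F :=
    (((measurable_inv_one_sub i).mul hδm).enorm).indicator hA
  have hc_meas : Measurable c :=
    ((hδm.enorm.indicator hA).comp (e.symm.measurable.comp measurable_prodMk_left))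
  have hmemA : ∀ (s : ℝ) (y : Fin m → ℝ), e.symm (s, y) ∈ A ↔ e.symm (1 / 2, y) ∈ A := by
    intro s y
    constructor
    · intro h; rw [he_upd s]; exact hAi _ _ h
    · intro h; rw [he_upd (1 / 2)]; exact hAi _ _ h
  have hδ_eq : ∀ (s : ℝ) (y : Fin m → ℝ), δ (e.symm (s, y)) =
      (Ioo (0 : ℝ) 1).indicator (fun _ => δ (e.symm (1 / 2, y))) s := by
    intro s y
    rw [he_upd (1 / 2) s y, hδ.apply_update hi]
    by_cases hs : s ∈ Ioo (0 : ℝ) 1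
    · rw [indicator_of_mem hs, indicator_of_mem hs]
      congr 1
      rw [← he_upd]
    · rw [indicator_of_notMem hs, indicator_of_notMem hs]
  have hpoint : ∀ (s : ℝ) (y : Fin m → ℝ), F (e.symm (s, y)) =
      c y * (Ioo (0 : ℝ) 1).indicator (fun s => ‖(1 - s)⁻¹‖ₑ) s := by
    intro s y
    simp only [hF_def, hc_def]
    by_cases hyA : e.symm (1 / 2, y) ∈ A
    · rw [indicator_of_mem ((hmemA s y).2 hyA), indicator_of_mem hyA, he_apply, hδ_eq s y]
      by_cases hs : s ∈ Ioo (0 : ℝ) 1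
      · rw [indicator_of_mem hs, indicator_of_mem hs, enorm_mul, mul_comm]
      · rw [indicator_of_notMem hs, indicator_of_notMem hs]; simp
    · rw [indicator_of_notMem (fun h => hyA ((hmemA s y).1 h)), indicator_of_notMem hyA, zero_mul]
  -- the finite integral, transported and disintegrated
  have hfin : ∫⁻ t, F t < ∞ := by
    rw [hF_def, lintegral_indicator hA]; exact hint.2
  have h1 : ∫⁻ t, F t = ∫⁻ p, F (e.symm p) ∂((volume : Measure ℝ).prod (volume : Measure (Fin m → ℝ))) := by
    rw [← Measure.volume_eq_prod]
    exact ((he.symm e).lintegral_comp_emb e.symm.measurableEmbedding _).symm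
  have h2 : ∫⁻ p, F (e.symm p) ∂((volume : Measure ℝ).prod (volume : Measure (Fin m → ℝ))) =
      ∫⁻ y, ∫⁻ s, F (e.symm (s, y)) :=
    lintegral_prod_symm _ (hF_meas.comp e.symm.measurable).aemeasurable
  have hm1 : Measurable fun s : ℝ => (1 - s)⁻¹ := (measurable_const.sub measurable_id).inv
  have hmi : Measurable ((Ioo (0 : ℝ) 1).indicator fun s : ℝ => ‖(1 - s)⁻¹‖ₑ) :=
    hm1.enorm.indicator measurableSet_Ioo
  have h3 : ∀ y, ∫⁻ s, F (e.symm (s, y)) = c y * ∞ := by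
    intro y
    simp_rw [hpoint]
    rw [lintegral_const_mul (c y) hmi, lintegral_indicator measurableSet_Ioo,
      lintegral_enorm_inv_one_sub_Ioo]
  rw [h1, h2] at hfin
  simp_rw [h3] at hfin
  rw [lintegral_mul_const _ hc_meas] at hfin
  have hc0 : ∫⁻ y, c y = 0 := by
    by_contra hne
    rw [ENNReal.mul_top hne] at hfin
    exact lt_irrefl _ hfin
  have hN : volume {y | c y ≠ 0} = 0 := by
    have := (lintegral_eq_zero_iff hc_meas).1 hc0
    rw [Filter.EventuallyEq, ae_iff] at this
    simpa using this
  -- the bad set is contained in the preimage of `ℝ × {c ≠ 0}`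
  have hNm : MeasurableSet {y | c y ≠ 0} := (hc_meas (measurableSet_singleton 0)).compl
  have hpre : volume (e ⁻¹' (univ ×ˢ {y | c y ≠ 0})) = 0 := by
    rw [he.measure_preimage (MeasurableSet.univ.prod hNm).nullMeasurableSet,
      Measure.volume_eq_prod, Measure.prod_prod, hN, mul_zero]
  rw [ae_iff]
  refine measure_mono_null (fun t ht => ?_) hpre
  simp only [mem_setOf_eq, Classical.not_imp] at ht
  obtain ⟨htA, hδt⟩ := ht
  have hti : t i ∈ Ioo (0 : ℝ) 1 := hδ.1 t hδt i hi
  refine ⟨mem_univ _, ?_⟩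
  simp only [mem_setOf_eq]
  have hrep : e.symm (1 / 2, (e t).2) = Function.update t i (1 / 2) := by
    have h0 : e.symm ((e t).1, (e t).2) = t := by simp
    rw [he_upd (e t).1, h0]
  change c (e t).2 ≠ 0
  simp only [hc_def]
  rw [hrep, indicator_of_mem (hAi _ _ htA)]
  have h12 : (1 / 2 : ℝ) ∈ Ioo (0 : ℝ) 1 := by norm_num
  rw [hδ.2 t i hi (1 / 2) h12 hti]
  simpa using hδt

/-! ### Uniqueness of residues -/

/-- A coordinate hyperplane `{t | t j = 1}` is Lebesgue-null in `ℝⁿ`. [folklore] -/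
theorem volume_setOf_apply_eq_one (j : Fin n) : volume {t : Fin n → ℝ | t j = 1} = 0 := by
  have hset : {t : Fin n → ℝ | t j = 1} =
      Set.pi univ (fun k => if k = j then ({1} : Set ℝ) else univ) := by
    ext t
    simp only [mem_setOf_eq, mem_univ_pi]
    constructor
    · intro h k
      by_cases hk : k = j
      · subst hk; simp [h]
      · simp [hk]
    · intro h; simpa using h j
  rw [hset, volume_pi_pi]
  exact Finset.prod_eq_zero (Finset.mem_univ j) (by simp)

/-- Almost every point of `ℝⁿ` lies off all the divergence faces `{t j = 1}`, `j ∈ D`. [folklore] -/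
theorem ae_forall_apply_ne_one (D : Finset (Fin n)) :
    ∀ᵐ t : Fin n → ℝ ∂volume, ∀ j ∈ D, t j ≠ 1 := by
  rw [Filter.eventually_all_finset]
  intro j _
  rw [ae_iff]
  simpa using volume_setOf_apply_eq_one j

/-- Off the faces, every point lies in some cutoff region `cutoff X (1/(k+1))`. [folklore] -/
theorem exists_mem_cutoff (X : Finset (Fin n)) {t : Fin n → ℝ} (ht : ∀ j ∈ X, t j ≠ 1) :
    ∃ k : ℕ, t ∈ cutoff X (1 / ((k : ℝ) + 1)) := by
  have : ∀ j : Fin n, ∃ k : ℕ, j ∈ X → 1 / ((k : ℝ) + 1) ≤ |1 - t j| := by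
    intro j
    by_cases hj : j ∈ X
    · have hpos : 0 < |1 - t j| := abs_pos.2 (sub_ne_zero.2 (Ne.symm (ht j hj)))
      obtain ⟨k, hk⟩ := exists_nat_one_div_lt hpos
      exact ⟨k, fun _ => hk.le⟩
    · exact ⟨0, fun h => (hj h).elim⟩
  choose kf hkf using this
  refine ⟨Finset.univ.sup kf, fun j hj => le_trans ?_ (hkf j hj)⟩
  have hle : (kf j : ℝ) + 1 ≤ (Finset.univ.sup kf : ℕ) + 1 := by
    have : kf j ≤ Finset.univ.sup kf := Finset.le_sup (Finset.mem_univ j)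
    exact_mod_cast Nat.succ_le_succ this
  exact one_div_le_one_div_of_le (by positivity) hle

namespace IsResidueSystem

variable {D : Finset (Fin n)} {ρ ρ' : Finset (Fin n) → (Fin n → ℝ) → ℝ}

/-- The residue system of the face `i`: `V ↦ ρ (insert i V)` relative to `D.erase i`; its
remainders are remainders of the original system. [folklore] -/
theorem rem_face (D : Finset (Fin n)) (ρ : Finset (Fin n) → (Fin n → ℝ) → ℝ) (i : Fin n)
    (S : Finset (Fin n)) :
    rem (D.erase i) (fun V => ρ (insert i V)) S = rem D ρ (insert i S) := by
  funext t
  simp only [rem]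
  have hidx : (D.erase i) \ S = D \ insert i S := by
    ext j; simp [Finset.mem_sdiff, Finset.mem_erase]; tauto
  rw [hidx]
  refine Finset.sum_congr rfl fun T _ => ?_
  rw [Finset.insert_union]

/-- The face system of an admissible system is admissible. [folklore] -/
theorem face (h : IsResidueSystem D ρ) {i : Fin n} (hi : i ∈ D) :
    IsResidueSystem (D.erase i) (fun V => ρ (insert i V)) where
  cylindrical V hV := (h.cylindrical (insert i V)
    (Finset.insert_subset hi (hV.trans (Finset.erase_subset _ _)))).mono (Finset.subset_insert _ _)
  measurable V hV := h.measurable (insert i V)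
    (Finset.insert_subset hi (hV.trans (Finset.erase_subset _ _)))
  integrable_rem S hS := by
    rw [rem_face]
    exact h.integrable_rem (insert i S) (Finset.insert_subset hi (hS.trans (Finset.erase_subset _ _)))

/-- **Uniqueness, codimension one.** If all remainders of `ρ` are integrable and `ρ ∅ = 0` a.e.,
then every codimension-one residue `ρ {i}` vanishes a.e. (cutoff lemma with `W = {i}` and the
Tonelli step on each cutoff region, exhausted over `ε = 1/(k+1)`). [folklore] -/
theorem ae_eq_zero_singleton (h : IsResidueSystem D ρ) (h0 : ρ ∅ =ᵐ[volume] 0) {i : Fin n}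
    (hi : i ∈ D) : ρ {i} =ᵐ[volume] 0 := by
  obtain ⟨m, rfl⟩ : ∃ m, n = m + 1 := ⟨n - 1, by have := i.pos; omega⟩
  have hi' : ({i} : Finset (Fin (m + 1))) ⊆ D := Finset.singleton_subset_iff.2 hi
  have hint0 : Integrable (ρ ∅) volume := (integrable_zero _ _ _).congr h0.symm
  -- on each cutoff region the residue vanishes a.e.
  have hk : ∀ k : ℕ, ∀ᵐ t ∂volume, t ∈ cutoff (D \ {i}) (1 / ((k : ℝ) + 1)) → ρ {i} t = 0 := by
    intro k
    have hε : (0 : ℝ) < 1 / ((k : ℝ) + 1) := by positivity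
    have hW : ({i} : Finset (Fin (m + 1))) ⊆ D \ ∅ := by simpa using hi'
    have hp := h.integrableOn_prem hε _ ∅ {i} (Finset.empty_subset _) hW rfl
    have hpeq : prem ρ ∅ {i} = fun t => ρ ∅ t - (1 - t i)⁻¹ * ρ {i} t := by
      funext t
      have := prem_insert ρ (S := ∅) (W := ∅) (Finset.notMem_empty i) t
      simpa using this
    have hset : (D \ ∅) \ {i} = D \ {i} := by simp
    rw [hpeq, hset] at hp
    have hq : IntegrableOn (fun t => (1 - t i)⁻¹ * ρ {i} t) (cutoff (D \ {i}) (1 / ((k : ℝ) + 1))) := by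
      have := hint0.integrableOn.sub hp
      refine this.congr_fun (fun t _ => ?_) (measurableSet_cutoff _ _)
      simp
    refine ae_eq_zero_of_cylindrical i (h.cylindrical {i} hi') (h.measurable {i} hi')
      (measurableSet_cutoff _ _) (fun t s ht j hj => ?_) hq
    have hji : j ≠ i := by
      intro hji; subst hji; simp at hj
    simpa [Function.update_of_ne hji] using ht j hj
  rw [← ae_all_iff] at hk
  filter_upwards [hk, ae_forall_apply_ne_one (D \ {i})] with t ht ht1
  obtain ⟨k, hk'⟩ := exists_mem_cutoff (D \ {i}) ht1
  exact ht k hk'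

/-- **Uniqueness of residues.** Two admissible residue systems relative to the same `D` whose
functions `ρ ∅`, `ρ' ∅` agree a.e. have a.e.-equal residues along every face (induction on
`|D|`: codimension one by `ae_eq_zero_singleton`, then pass to the face systems). Consequently
the regularised value depends only on the a.e.-class of the function regularised. [folklore] -/
theorem ae_eq : ∀ (k : ℕ) (D : Finset (Fin n)) (ρ ρ' : Finset (Fin n) → (Fin n → ℝ) → ℝ),
    D.card = k → IsResidueSystem D ρ → IsResidueSystem D ρ' → ρ ∅ =ᵐ[volume] ρ' ∅ →
      ∀ U, U ⊆ D → ρ U =ᵐ[volume] ρ' U := by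
  intro k
  induction k with
  | zero =>
    intro D ρ ρ' hD h h' h0 U hU
    rw [Finset.card_eq_zero] at hD
    subst hD
    rw [Finset.subset_empty] at hU
    subst hU
    exact h0
  | succ k ih =>
    intro D ρ ρ' hD h h' h0 U hU
    rcases U.eq_empty_or_nonempty with rfl | ⟨i, hiU⟩
    · exact h0
    have hi : i ∈ D := hU hiU
    -- codimension one
    have h1 : ρ {i} =ᵐ[volume] ρ' {i} := by
      have hs := (h.sub h').ae_eq_zero_singleton (h0.mono fun t ht => by simp [ht]) hi
      exact hs.mono fun t ht => sub_eq_zero.1 (by simpa using ht)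
    -- pass to the face `i`
    have hcard : (D.erase i).card = k := by rw [Finset.card_erase_of_mem hi, hD]; rfl
    have := ih (D.erase i) (fun V => ρ (insert i V)) (fun V => ρ' (insert i V)) hcard
      (h.face hi) (h'.face hi) (by simpa using h1) (U.erase i)
      (Finset.erase_subset_erase i hU)
    simpa [Finset.insert_erase hiU] using this

/-- A.e.-equal residues give a.e.-equal remainders. [folklore] -/
theorem rem_ae_eq (hρ : ∀ U, U ⊆ D → ρ U =ᵐ[volume] ρ' U) (S : Finset (Fin n)) (hS : S ⊆ D) :
    rem D ρ S =ᵐ[volume] rem D ρ' S := by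
  have : ∀ᵐ t ∂volume, ∀ T ∈ (D \ S).powerset, ρ (S ∪ T) t = ρ' (S ∪ T) t := by
    rw [Filter.eventually_all_finset]
    intro T hT
    exact hρ (S ∪ T) (Finset.union_subset hS
      ((Finset.mem_powerset.1 hT).trans Finset.sdiff_subset))
  filter_upwards [this] with t ht
  simp only [rem]
  exact Finset.sum_congr rfl fun T hT => by rw [ht T hT]

/-- **The regularised value depends only on the a.e.-class of the function regularised** (same
`D`). [folklore] -/
theorem regValue_congr (h : IsResidueSystem D ρ) (h' : IsResidueSystem D ρ')
    (h0 : ρ ∅ =ᵐ[volume] ρ' ∅) : regValue D ρ = regValue D ρ' :=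
  integral_congr_ae (rem_ae_eq (ae_eq D.card D ρ ρ' rfl h h' h0) ∅ (Finset.empty_subset _))

/-- **The regularised value depends only on the a.e.-class of the function regularised**, for
possibly different sets of divergent coordinates (extend both systems by zero to `D ∪ D'`).
[folklore] -/
theorem regValue_congr' {D' : Finset (Fin n)} (h : IsResidueSystem D ρ) (h' : IsResidueSystem D' ρ')
    (h0 : ρ ∅ =ᵐ[volume] ρ' ∅) : regValue D ρ = regValue D' ρ' := by
  have e1 : regValue D ρ = regValue (D ∪ D') (extendZero D ρ) :=
    (regValue_extendZero (ρ := ρ) (Finset.subset_union_left (s₂ := D'))).symm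
  have e2 : regValue D' ρ' = regValue (D ∪ D') (extendZero D' ρ') :=
    (regValue_extendZero (ρ := ρ') (Finset.subset_union_right (s₁ := D))).symm
  rw [e1, e2]
  refine regValue_congr (h.extend Finset.subset_union_left) (h'.extend Finset.subset_union_right) ?_
  rwa [extendZero_of_subset (Finset.empty_subset _), extendZero_of_subset (Finset.empty_subset _)]

/-- **Additivity of regularised values**: if `ρ ∅ = ρ₁ ∅ + ρ₂ ∅` a.e. for three admissible systems
(relative to possibly different divergent coordinates), then the values add. [folklore] -/
theorem regValue_eq_add {D₁ D₂ : Finset (Fin n)} {ρ₁ ρ₂ : Finset (Fin n) → (Fin n → ℝ) → ℝ}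
    (h : IsResidueSystem D ρ) (h₁ : IsResidueSystem D₁ ρ₁) (h₂ : IsResidueSystem D₂ ρ₂)
    (h0 : ρ ∅ =ᵐ[volume] ρ₁ ∅ + ρ₂ ∅) :
    regValue D ρ = regValue D₁ ρ₁ + regValue D₂ ρ₂ := by
  set E := D₁ ∪ D₂ with hE
  have h₁' := h₁.extend (Finset.subset_union_left (s₂ := D₂))
  have h₂' := h₂.extend (Finset.subset_union_right (s₁ := D₁))
  have hsum := h₁'.add h₂'
  have h0' : ρ ∅ =ᵐ[volume] (extendZero D₁ ρ₁ + extendZero D₂ ρ₂) ∅ := by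
    simpa [extendZero_of_subset (Finset.empty_subset D₁),
      extendZero_of_subset (Finset.empty_subset D₂)] using h0
  have e1 : regValue D₁ ρ₁ = regValue E (extendZero D₁ ρ₁) :=
    (regValue_extendZero (ρ := ρ₁) (Finset.subset_union_left (s₂ := D₂))).symm
  have e2 : regValue D₂ ρ₂ = regValue E (extendZero D₂ ρ₂) :=
    (regValue_extendZero (ρ := ρ₂) (Finset.subset_union_right (s₁ := D₁))).symm
  rw [regValue_congr' h hsum h0', e1, e2]
  simp only [regValue]
  rw [rem_add]
  simp only [Pi.add_apply]
  exact integral_add (h₁'.integrable_rem ∅ (Finset.empty_subset _))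
    (h₂'.integrable_rem ∅ (Finset.empty_subset _))

end IsResidueSystem

/-! ### Semialgebraicity of the corner-chart constructions -/

/-- The face map is a polynomial map. [folklore] -/
theorem faceMap_eq_aeval (T : Finset (Fin n)) (t : Fin n → ℝ) :
    faceMap T t = fun j => aeval t (if j ∈ T then (1 : MvPolynomial (Fin n) ℚ) else X j) := by
  ext j
  by_cases hj : j ∈ T <;> simp [faceMap, hj]

/-- The divergence factor is a polynomial. [folklore] -/
theorem divProd_eq_aeval (U : Finset (Fin n)) (t : Fin n → ℝ) :
    divProd U t = aeval t (∏ i ∈ U, (1 - X i : MvPolynomial (Fin n) ℚ)) := by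
  simp [divProd, map_prod]

/-- The face map is `ℚ`-semialgebraic on any `ℚ`-semialgebraic set. [folklore] -/
theorem isSemialgebraicMapOn_faceMap (T : Finset (Fin n)) {σ : Set (Fin n → ℝ)}
    (hσ : IsSemialgebraic ℚ σ) : IsSemialgebraicMapOn ℚ σ (faceMap T) := by
  have := isSemialgebraicMapOn_aeval hσ (fun j => if j ∈ T then (1 : MvPolynomial (Fin n) ℚ) else X j)
  exact this.congr fun t _ => (faceMap_eq_aeval T t).symm

/-- Footprints of semialgebraic sets are semialgebraic (Tarski–Seidenberg, through
`IsSemialgebraicMapOn.isSemialgebraic_image_holds`). [folklore] -/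
theorem isSemialgebraic_faceImage (T : Finset (Fin n)) {σ : Set (Fin n → ℝ)}
    (hσ : IsSemialgebraic ℚ σ) : IsSemialgebraic ℚ (faceImage T σ) :=
  IsSemialgebraicMapOn.isSemialgebraic_image_holds (isSemialgebraicMapOn_faceMap T hσ) subset_rfl hσ

/-- The open unit thickening condition is semialgebraic. [folklore] -/
theorem isSemialgebraic_thick (T : Finset (Fin n)) : IsSemialgebraic ℚ (thick (n := n) T) := by
  have : thick (n := n) T = ⋂ i ∈ T, ({t : Fin n → ℝ | 0 < t i} ∩ {t | t i < 1}) := by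
    ext t; simp [thick]
  rw [this]
  refine IsSemialgebraic.biInter T _ fun i _ => ?_
  refine IsSemialgebraic.inter ?_ ?_
  · simpa using isSemialgebraic_setOf_eval_pos (k := ℚ) (R := ℝ) (X i : MvPolynomial (Fin n) ℚ)
  · simpa using isSemialgebraic_setOf_eval_lt (k := ℚ) (R := ℝ) (X i : MvPolynomial (Fin n) ℚ) 1

/-- Thickened face pieces of semialgebraic sets are semialgebraic. [folklore] -/
theorem isSemialgebraic_cyl (T : Finset (Fin n)) {σ : Set (Fin n → ℝ)} (hσ : IsSemialgebraic ℚ σ) :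
    IsSemialgebraic ℚ (cyl T σ) := by
  refine (isSemialgebraic_thick T).inter ?_
  have := (isSemialgebraic_faceImage T hσ).preimage_aeval
    (fun j => if j ∈ T then (1 : MvPolynomial (Fin n) ℚ) else X j)
  convert this using 1
  ext t
  simp only [mem_preimage, faceMap_eq_aeval T t]

/-- A function defined piecewise from two semialgebraic functions along a semialgebraic set is
semialgebraic. [folklore] -/
theorem _root_.Literature.NumberTheory.Transcendental.IsSemialgebraicFunOn.piecewise {m : ℕ}
    {s A : Set (Fin m → ℝ)} {f g : (Fin m → ℝ) → ℝ} [∀ x, Decidable (x ∈ A)]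
    (hf : IsSemialgebraicFunOn ℚ (s ∩ A) f) (hg : IsSemialgebraicFunOn ℚ (s \ A) g) :
    IsSemialgebraicFunOn ℚ s (A.piecewise f g) := by
  rw [isSemialgebraicFunOn_iff] at hf hg ⊢
  convert hf.union hg using 1
  ext z
  simp only [mem_setOf_eq, mem_union, mem_inter_iff, Set.mem_sdiff]
  by_cases hz : Fin.init z ∈ A
  · rw [Set.piecewise_eq_of_mem _ _ _ hz]; tauto
  · rw [Set.piecewise_eq_of_notMem _ _ _ hz]; tauto

/-- The extension by zero of a semialgebraic function off a semialgebraic set is semialgebraic on any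
semialgebraic superset. [folklore] -/
theorem _root_.Literature.NumberTheory.Transcendental.IsSemialgebraicFunOn.indicator {m : ℕ}
    {s A : Set (Fin m → ℝ)} {f : (Fin m → ℝ) → ℝ} (hs : IsSemialgebraic ℚ s)
    (hA : IsSemialgebraic ℚ A) (hf : IsSemialgebraicFunOn ℚ (s ∩ A) f) :
    IsSemialgebraicFunOn ℚ s (A.indicator f) := by
  have h0 : IsSemialgebraicFunOn ℚ (s \ A) (fun _ => (0 : ℝ)) :=
    (isSemialgebraicFunOn_aeval (hs.diff hA) 0).congr fun x _ => by simp
  rw [isSemialgebraicFunOn_iff] at hf h0 ⊢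
  convert hf.union h0 using 1
  ext z
  simp only [mem_setOf_eq, mem_union, mem_inter_iff, Set.mem_sdiff]
  by_cases hz : Fin.init z ∈ A
  · rw [indicator_of_mem hz]; tauto
  · rw [indicator_of_notMem hz]; tauto

/-! ### Regularised integral representations -/

/-- The integrand of the face `T` of corner data `(g, D)`: the residue numerator `g ∘ faceMap T`
divided by the remaining divergence factors, `g(t[T:=1]) / Π_{D \ T}(t)`; for `T = ∅` this is the
integrand `g / Π_D` itself. [cite: DupontPanzerPym2026, Prop. 7.15 (proof: residues along strata)] -/
def faceIntegrand (g : (Fin n → ℝ) → ℝ) (D T : Finset (Fin n)) (t : Fin n → ℝ) : ℝ :=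
  g (faceMap T t) / divProd (D \ T) t

/-- The RESIDUE SYSTEM of corner data `(σ, g, D)`: the face integrands extended by zero off the
thickened face pieces `cyl T σ` (`T = ∅`: the integrand extended by zero off `σ`).
[cite: DupontPanzerPym2026, Ex. 7.13] -/
def resSys (σ : Set (Fin n → ℝ)) (g : (Fin n → ℝ) → ℝ) (D : Finset (Fin n)) :
    Finset (Fin n) → (Fin n → ℝ) → ℝ := fun T => (cyl T σ).indicator (faceIntegrand g D T)

/-- The integrand of the empty face is the integrand `g / Π_D`. [folklore] -/
theorem faceIntegrand_empty (g : (Fin n → ℝ) → ℝ) (D : Finset (Fin n)) :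
    faceIntegrand g D ∅ = fun t => g t / divProd D t := by
  funext t; simp [faceIntegrand]

/-- The residue of the empty face is the integrand extended by zero off `σ`. [folklore] -/
theorem resSys_empty (σ : Set (Fin n → ℝ)) (g : (Fin n → ℝ) → ℝ) (D : Finset (Fin n)) :
    resSys σ g D ∅ = σ.indicator fun t => g t / divProd D t := by
  simp [resSys, faceIntegrand_empty]

/-- A **regularised integral representation** on a corner chart, in dimension `n` (the posited
object `KZreg` of route KontsevichZagierPeriods/Deregularisation; Dupont–Panzer–Pym's regularised
integrals restricted to `ℚ`-semialgebraic corner data with unit tangential data): a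
`ℚ`-semialgebraic domain `σ ⊆ ℝⁿ`, a finite set `D` of DIVERGENT COORDINATES whose faces are the
hyperplanes `{tᵢ = 1}` bounding `σ` from above (`tᵢ < 1` on `σ` for `i ∈ D`), and a NUMERATOR `g`;
the integrand is `f = g / ∏_{i ∈ D} (1 - tᵢ)`. The numerator is `ℚ`-semialgebraic on `σ` and on
every footprint `faceImage T σ` (`T ⊆ D`) — its values there are the residues — and the datum is
ADMISSIBLE: every face remainder of its residue system (inclusion–exclusion subtraction of the
residues along the thickened faces, `rem`) is absolutely integrable. For `D = ∅` this is exactly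
the data of `KZ.IntegralRep` (`ofKZ`; and `mainPiece (ofKZ r) = r`). Tangential data: the unit scale
`∂/∂(1 - tᵢ)` on every face (Deligne's `∂/∂t`; general rational scales are not part of this
version).
[cite: DupontPanzerPym2026, Thm.-Def. 1.5 and Def. 7.6 (regularised integral), Ex. 7.13 (coordinate form)] -/
structure IntegralRep (n : ℕ) where
  /-- The domain of integration `σ ⊆ ℝⁿ`. -/
  domain : Set (Fin n → ℝ)
  /-- The numerator `g`; the integrand is `g / ∏_{i ∈ div} (1 - tᵢ)`. Its values on `domain` and
  on the footprints `faceImage T domain`, `T ⊆ div`, matter. -/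
  num : (Fin n → ℝ) → ℝ
  /-- The divergent coordinates: the integrand may diverge logarithmically at the faces
  `{tᵢ = 1}`, `i ∈ div`. -/
  div : Finset (Fin n)
  /-- The divergence faces bound the domain from above. -/
  lt_one : ∀ t ∈ domain, ∀ i ∈ div, t i < 1
  /-- The domain is `ℚ`-semialgebraic. -/
  isSemialgebraic_domain : IsSemialgebraic ℚ domain
  /-- The numerator is `ℚ`-semialgebraic on the domain (`T = ∅`) and on every footprint. -/
  isSemialgebraicFunOn_num : ∀ T, T ⊆ div → IsSemialgebraicFunOn ℚ (faceImage T domain) num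
  /-- Admissibility: every face remainder of the residue system is absolutely integrable. -/
  integrable_rem : ∀ S, S ⊆ div → Integrable (rem div (resSys domain num div) S)

variable {m l : ℕ}

namespace IntegralRep

/-- The integrand `f = g / ∏_{i ∈ D} (1 - tᵢ)` of a regularised representation.
[cite: DupontPanzerPym2026, Ex. 7.13] -/
def integrand (r : IntegralRep n) (t : Fin n → ℝ) : ℝ := r.num t / divProd r.div t

/-- The residue system of a regularised representation. [cite: DupontPanzerPym2026, Ex. 7.13] -/
def resSys (r : IntegralRep n) : Finset (Fin n) → (Fin n → ℝ) → ℝ := KZreg.resSys r.domain r.num r.div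

/-- The SUBTRACTED INTEGRAND (remainder of the empty face) of a regularised representation:
`∑_{T ⊆ D} (-1)^{|T|} 1_{cyl T σ} g(t[T:=1]) / Π_D(t)`. [cite: DupontPanzerPym2026, Ex. 7.13] -/
def subIntegrand (r : IntegralRep n) : (Fin n → ℝ) → ℝ := rem r.div r.resSys ∅

/-- The **regularised value** of a representation: the integral over `ℝⁿ` of its subtracted
integrand. This is Dupont–Panzer–Pym's regularised integral `∫_{(Σ,s)} ω` computed in the corner
chart with unit scales: the classical regularised integral of Ex. 7.13
(`reg ∫₀^a f dr/r = f(0) log a + ∫₀^a (f - f(0)) dr/r`, here `a = 1` so the boundary constant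
vanishes), iterated over the divergence faces by Fubini (Cor. 7.10) and equal to the ordinary
integral when the latter converges absolutely (Prop. 7.15; here: `D = ∅`, `value_ofKZ`).
[cite: DupontPanzerPym2026, Thm.-Def. 1.5, Ex. 7.13, Cor. 7.10, Prop. 7.15] -/
def value (r : IntegralRep n) : ℝ := ∫ t, r.subIntegrand t

/-- Unfolding the residue system of a representation. [folklore] -/
theorem resSys_apply (r : IntegralRep n) (T : Finset (Fin n)) :
    r.resSys T = (cyl T r.domain).indicator (faceIntegrand r.num r.div T) := rfl

/-- The residue of the empty face of a representation is its zero-extended integrand. [folklore] -/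
theorem resSys_empty (r : IntegralRep n) : r.resSys ∅ = r.domain.indicator r.integrand := by
  rw [resSys, KZreg.resSys_empty]; rfl

/-- The regularised value is the value of the residue system. [folklore] -/
theorem value_eq_regValue (r : IntegralRep n) : r.value = regValue r.div r.resSys := rfl

/-- The divergence factor does not vanish on the domain. [folklore] -/
theorem divProd_ne_zero_of_mem (r : IntegralRep n) {t : Fin n → ℝ} (ht : t ∈ r.domain) :
    divProd r.div t ≠ 0 :=
  divProd_ne_zero fun i hi => (r.lt_one t ht i hi).ne

/-- On a thickened face piece the remaining divergent coordinates stay below `1`. [folklore] -/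
theorem lt_one_of_mem_cyl (r : IntegralRep n) {T : Finset (Fin n)} {t : Fin n → ℝ}
    (ht : t ∈ cyl T r.domain) {i : Fin n} (hi : i ∈ r.div) (hiT : i ∉ T) : t i < 1 := by
  obtain ⟨-, s, hs, hst⟩ := mem_cyl_iff.1 ht
  have := congr_fun hst i
  rw [faceMap_apply_of_not_mem hiT, faceMap_apply_of_not_mem hiT] at this
  rw [← this]
  exact r.lt_one s hs i hi

/-- The face integrands are `ℚ`-semialgebraic on the thickened face pieces. [folklore] -/
theorem isSemialgebraicFunOn_faceIntegrand (r : IntegralRep n) {T : Finset (Fin n)} (hT : T ⊆ r.div) :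
    IsSemialgebraicFunOn ℚ (cyl T r.domain) (faceIntegrand r.num r.div T) := by
  have hcyl := isSemialgebraic_cyl T r.isSemialgebraic_domain
  -- the numerator composed with the face map
  have hg : IsSemialgebraicFunOn ℚ (cyl T r.domain) (fun t => r.num (faceMap T t)) := by
    have hG := isSemialgebraicFunOn_iff.1 (r.isSemialgebraicFunOn_num T hT)
    rw [isSemialgebraicFunOn_iff]
    let Q : Fin (n + 1) → MvPolynomial (Fin (n + 1)) ℚ :=
      Fin.snoc (fun i => if i ∈ T then 1 else X (Fin.castSucc i)) (X (Fin.last n))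
    have hpre := hG.preimage_aeval Q
    have hP : ∀ z : Fin (n + 1) → ℝ, (fun j => aeval z (Q j)) =
        Fin.snoc (faceMap T (Fin.init z)) (z (Fin.last n)) := by
      intro z
      ext j
      refine Fin.lastCases ?_ (fun i => ?_) j
      · simp [Q]
      · by_cases hi : i ∈ T <;> simp [Q, faceMap, hi, Fin.init]
    convert ((isSemialgebraic_thick T).setOf_init_mem).inter hpre using 1
    ext z
    simp only [mem_setOf_eq, mem_inter_iff, mem_preimage, hP, Fin.init_snoc, Fin.snoc_last, cyl,
      mem_inter_iff, mem_preimage]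
    tauto
  have hq : IsSemialgebraicFunOn ℚ (cyl T r.domain) (fun t => (divProd (r.div \ T) t)⁻¹) := by
    have := isSemialgebraicFunOn_aeval_div_aeval hcyl 1
      (∏ i ∈ r.div \ T, (1 - X i : MvPolynomial (Fin n) ℚ)) (fun t ht => ?_)
    · refine this.congr fun t _ => ?_
      beta_reduce
      rw [← divProd_eq_aeval]
      simp [one_div]
    · rw [← divProd_eq_aeval]
      exact divProd_ne_zero fun i hi => (r.lt_one_of_mem_cyl ht (Finset.mem_sdiff.1 hi).1
        (Finset.mem_sdiff.1 hi).2).ne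
  exact (IsSemialgebraicFunOn.mul_holds hg hq).congr fun t _ => by
    simp [faceIntegrand, div_eq_mul_inv]

/-- The residues are Borel measurable on all of `ℝⁿ` (semialgebraic on the thickened face piece,
zero outside). [folklore] -/
theorem measurable_resSys (r : IntegralRep n) {T : Finset (Fin n)} (hT : T ⊆ r.div) :
    Measurable (r.resSys T) := by
  have hcyl := isSemialgebraic_cyl T r.isSemialgebraic_domain
  have hm : MeasurableSet (cyl T r.domain) :=
    Literature.ModelTheory.ExponentialFields.IsSemialgebraic.measurableSet_holds hcyl
  refine measurable_of_restrict_of_restrict_compl hm ?_ ?_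
  · have hmeas := IsSemialgebraicFunOn.measurable_holds (r.isSemialgebraicFunOn_faceIntegrand hT)
    have : (cyl T r.domain).restrict (r.resSys T) =
        (cyl T r.domain).restrict (faceIntegrand r.num r.div T) := by
      funext ⟨x, hx⟩
      simp [resSys_apply, indicator_of_mem hx]
    rw [this]
    exact hmeas
  · have : (cyl T r.domain)ᶜ.restrict (r.resSys T) = fun _ => 0 := by
      funext ⟨x, hx⟩
      simp [resSys_apply, indicator_of_notMem (show x ∉ cyl T r.domain from hx)]
    rw [this]
    exact measurable_const

/-- Moving a coordinate of `T` inside `(0,1)` does not leave a thickened face piece. [folklore] -/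
theorem update_mem_cyl_iff {T : Finset (Fin n)} {σ : Set (Fin n → ℝ)} {t : Fin n → ℝ} {i : Fin n}
    (hi : i ∈ T) {s : ℝ} (hs : s ∈ Ioo (0 : ℝ) 1) (hti : t i ∈ Ioo (0 : ℝ) 1) :
    Function.update t i s ∈ cyl T σ ↔ t ∈ cyl T σ := by
  simp only [cyl, mem_inter_iff, mem_preimage, faceMap_update_of_mem hi, thick, mem_setOf_eq]
  refine and_congr_left fun _ => ⟨fun h j hj => ?_, fun h j hj => ?_⟩
  · by_cases hji : j = i
    · subst hji; exact hti
    · simpa [Function.update_of_ne hji] using h j hj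
  · by_cases hji : j = i
    · subst hji; simpa using hs
    · simpa [Function.update_of_ne hji] using h j hj

/-- The residues of a representation are cylindrical along their faces. [folklore] -/
theorem isCylindrical_resSys (r : IntegralRep n) (T : Finset (Fin n)) :
    IsCylindrical T (r.resSys T) := by
  refine ⟨fun t ht i hi => ?_, fun t i hi s hs hti => ?_⟩
  · have : t ∈ cyl T r.domain := by
      by_contra h
      exact ht (indicator_of_notMem h _)
    exact this.1 i hi
  · simp only [resSys_apply]
    by_cases ht : t ∈ cyl T r.domain
    · rw [indicator_of_mem ((update_mem_cyl_iff hi hs hti).2 ht), indicator_of_mem ht]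
      simp only [faceIntegrand, faceMap_update_of_mem hi,
        divProd_update_of_not_mem (fun h => (Finset.mem_sdiff.1 h).2 hi)]
    · rw [indicator_of_notMem (fun h => ht ((update_mem_cyl_iff hi hs hti).1 h)),
        indicator_of_notMem ht]

/-- **Admissibility as a residue system**: the residue system of a regularised representation is
admissible in the sense of `IsResidueSystem`. [folklore] -/
theorem isResidueSystem (r : IntegralRep n) : IsResidueSystem r.div r.resSys where
  cylindrical U _ := r.isCylindrical_resSys U
  measurable _ hT := r.measurable_resSys hT
  integrable_rem S hS := r.integrable_rem S hS

/-- The subtracted integrand is absolutely integrable on `ℝⁿ`. [folklore] -/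
theorem integrable_subIntegrand (r : IntegralRep n) : Integrable r.subIntegrand :=
  r.integrable_rem ∅ (Finset.empty_subset _)

/-- The subtracted integrand vanishes off the union of the thickened face pieces. [folklore] -/
theorem subIntegrand_eq_zero (r : IntegralRep n) {t : Fin n → ℝ}
    (ht : ∀ T ∈ r.div.powerset, t ∉ cyl T r.domain) : r.subIntegrand t = 0 := by
  simp only [subIntegrand, rem, Finset.sdiff_empty, Finset.empty_union]
  refine Finset.sum_eq_zero fun T hT => ?_
  rw [resSys_apply, indicator_of_notMem (ht T hT)]
  simp

end IntegralRep

/-! ### The formal group and evaluation -/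

/-- Formal `ℤ`-combinations of regularised representations of all dimensions.
[cite: KontsevichZagierPeriods2001, §1.2] -/
abbrev FormalRep : Type := FreeAbelianGroup (Σ n, IntegralRep n)

/-- The generator `[r]`. [folklore] -/
def of (r : IntegralRep n) : FormalRep := FreeAbelianGroup.of ⟨n, r⟩

/-- Evaluation `[r] ↦ value r` (the regularised value), extended additively.
[cite: DupontPanzerPym2026, Thm.-Def. 1.5] -/
def eval : FormalRep →+ ℝ := FreeAbelianGroup.lift fun r => r.2.value

/-- `eval [r] = value r`. [folklore] -/
@[simp] theorem eval_of (r : IntegralRep n) : eval (of r) = r.value :=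
  FreeAbelianGroup.lift_apply_of _ _

/-- Unfolding the subtracted integrand as the inclusion–exclusion sum over the faces. [folklore] -/
theorem IntegralRep.subIntegrand_apply (r : IntegralRep n) (t : Fin n → ℝ) :
    r.subIntegrand t = ∑ T ∈ r.div.powerset, (-1 : ℝ) ^ T.card * r.resSys T t / divProd T t := by
  simp [IntegralRep.subIntegrand, rem]

/-! ### The inclusion of the ordinary calculus (`D = ∅`) -/

/-- An ordinary KZ representation as a regularised one without divergent coordinates.
[cite: DupontPanzerPym2026, Prop. 7.15] -/
def ofKZ (r : KZ.IntegralRep n) : IntegralRep n where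
  domain := r.domain
  num := r.integrand
  div := ∅
  lt_one := fun _ _ _ hi => by simp at hi
  isSemialgebraic_domain := r.isSemialgebraic_domain
  isSemialgebraicFunOn_num T hT := by
    rw [Finset.subset_empty.1 hT, faceImage_empty]
    exact r.isSemialgebraicFunOn_integrand
  integrable_rem S hS := by
    rw [Finset.subset_empty.1 hS, rem_empty_empty, resSys_empty]
    simp only [divProd_empty, div_one]
    exact (integrable_indicator_iff (KZ.IntegralRep.measurableSet_domain_holds r)).2 r.integrableOn

/-- The domain of `ofKZ r`. [folklore] -/
@[simp] theorem ofKZ_domain (r : KZ.IntegralRep n) : (ofKZ r).domain = r.domain := rfl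

/-- The numerator of `ofKZ r` is the integrand of `r`. [folklore] -/
@[simp] theorem ofKZ_num (r : KZ.IntegralRep n) : (ofKZ r).num = r.integrand := rfl

/-- `ofKZ r` has no divergent coordinates. [folklore] -/
@[simp] theorem ofKZ_div (r : KZ.IntegralRep n) : (ofKZ r).div = ∅ := rfl

/-- The integrand of `ofKZ r` is the integrand of `r`. [folklore] -/
@[simp] theorem integrand_ofKZ (r : KZ.IntegralRep n) : (ofKZ r).integrand = r.integrand := by
  funext t; simp [IntegralRep.integrand]

/-- The subtracted integrand of `ofKZ r` is the zero-extended integrand of `r`. [folklore] -/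
theorem subIntegrand_ofKZ (r : KZ.IntegralRep n) :
    (ofKZ r).subIntegrand = r.domain.indicator r.integrand := by
  unfold IntegralRep.subIntegrand
  rw [ofKZ_div, rem_empty_empty, IntegralRep.resSys_empty, integrand_ofKZ, ofKZ_domain]

/-- **Absolutely convergent ⇒ regularised value = ordinary integral** (the case `D = ∅` of
Dupont–Panzer–Pym's Prop. 7.15, here by construction). [cite: DupontPanzerPym2026, Prop. 7.15] -/
@[simp] theorem value_ofKZ (r : KZ.IntegralRep n) : (ofKZ r).value = r.value := by
  rw [IntegralRep.value, subIntegrand_ofKZ,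
    integral_indicator (KZ.IntegralRep.measurableSet_domain_holds r)]
  rfl

/-- `ofKZ` is injective (domain and integrand are retained). [folklore] -/
theorem ofKZ_injective : Function.Injective (ofKZ (n := n)) := by
  intro r r' h
  have h1 : r.domain = r'.domain := congrArg IntegralRep.domain h
  have h2 : r.integrand = r'.integrand := congrArg IntegralRep.num h
  cases r; cases r'
  cases h1; cases h2
  rfl

/-- The sigma-map underlying `incl`. [folklore] -/
def sigmaOfKZ : (Σ n, KZ.IntegralRep n) → (Σ n, IntegralRep n) := Sigma.map id fun _ => ofKZ

/-- `sigmaOfKZ` is injective. [folklore] -/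
theorem sigmaOfKZ_injective : Function.Injective sigmaOfKZ :=
  Function.injective_id.sigma_map fun _ => ofKZ_injective

/-- **The inclusion `incl : KZ.FormalRep →+ KZreg.FormalRep`** (`[σ, f] ↦ [σ, f; D = ∅]` on
generators). [cite: DupontPanzerPym2026, Prop. 7.15] -/
def incl : KZ.FormalRep →+ FormalRep := FreeAbelianGroup.map sigmaOfKZ

/-- `incl` on generators. [folklore] -/
@[simp] theorem incl_of (r : KZ.IntegralRep n) : incl (KZ.of r) = of (ofKZ r) :=
  FreeAbelianGroup.map_of_apply _

/-- `incl` is injective. [folklore] -/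
theorem incl_injective : Function.Injective incl :=
  freeAbelianGroup_map_injective sigmaOfKZ_injective

/-- **Values are preserved**: `eval ∘ incl = KZ.eval`. [cite: DupontPanzerPym2026, Prop. 7.15] -/
theorem eval_incl (c : KZ.FormalRep) : eval (incl c) = KZ.eval c := by
  have hgen : ∀ r : Σ n, KZ.IntegralRep n,
      eval (incl (FreeAbelianGroup.of r)) = KZ.eval (FreeAbelianGroup.of r) := by
    rintro ⟨n, r⟩
    simp only [incl, eval, KZ.eval, FreeAbelianGroup.map_of_apply, FreeAbelianGroup.lift_apply_of,
      sigmaOfKZ, Sigma.map, id, value_ofKZ]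
  induction c using FreeAbelianGroup.induction_on with
  | zero => simp
  | of r => exact hgen r
  | neg r ih => rw [map_neg, map_neg, map_neg, hgen r]
  | add a b ha hb => simp [map_add, ha, hb]

/-! ### The moves -/

/-- **Move (a), additivity in the domain** — VERBATIM Kontsevich–Zagier's rule (1) for the domain,
for regularised representations with ARBITRARY (possibly different) divergent coordinates: if
`σ = σ₁ ∪ σ₂` with `σ₁ ∩ σ₂` null and the integrands `g/Π_D` agree on the pieces, then
`[r] - [r₁] - [r₂]` is a relation. No hypothesis on the residues is needed: by uniqueness of
residues (`IsResidueSystem.ae_eq`) the regularised value depends only on the integrand a.e., and is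
additive (Dupont–Panzer–Pym: linearity of `∫_{(Σ,s)}` and Cor. 7.9, extension by zero along open
embeddings). A piece on which the integrand converges absolutely may thus be split off with
`D = ∅`. [cite: DupontPanzerPym2026, Cor. 7.9] -/
def domainAddRel : Set FormalRep :=
  {c | ∃ (n : ℕ) (r r₁ r₂ : IntegralRep n), r.domain = r₁.domain ∪ r₂.domain ∧
    volume (r₁.domain ∩ r₂.domain) = 0 ∧ EqOn r.integrand r₁.integrand r₁.domain ∧
    EqOn r.integrand r₂.integrand r₂.domain ∧ c = of r - of r₁ - of r₂}

/-- **Move (b), additivity in the integrand** — verbatim Kontsevich–Zagier's rule (1) for the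
integrand (same domain, `f = f₁ + f₂` on it; divergent coordinates arbitrary): linearity of the
regularised integral. [cite: DupontPanzerPym2026, Thm.-Def. 1.5 (linear functional)] -/
def integrandAddRel : Set FormalRep :=
  {c | ∃ (n : ℕ) (r r₁ r₂ : IntegralRep n), r₁.domain = r.domain ∧ r₂.domain = r.domain ∧
    EqOn r.integrand (r₁.integrand + r₂.integrand) r.domain ∧ c = of r - of r₁ - of r₂}

/-- **Move (c), change of variables fixing the divergent coordinates.** Data: two representations
with the same divergent coordinates `D` and, for every face `T ⊆ D` (including `T = ∅`, where
`cyl ∅ σ = σ` and `faceIntegrand g D ∅ = g/Π_D` is the integrand), a `ℚ`-semialgebraic map `Φ_T`,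
injective and differentiable within the thickened face piece `cyl T σ`, mapping it onto
`cyl T σ'`, FIXING THE DIVERGENT COORDINATES (`(Φ_T x)ᵢ = xᵢ`, `i ∈ D`: unit normal derivative at
every divergence face, so no anomaly term arises) and transporting the face integrands with the
Jacobian: `f_T(x) = f'_T(Φ_T x) |det Φ'_T x|`. Then `[r] - [r']` is a relation. For `D = ∅` this is
verbatim `KZ.changeOfVariablesRel`; the `u`-dependent shear `(u, x₁, x') ↦ (u, u x₁, x')` of route
Deregularisation (`D = {u}`, face map the identity) is an instance. Dupont–Panzer–Pym's Cor. 7.9 is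
the invariance of `∫_{(Σ,s)}` under isomorphisms preserving the regularisation; maps moving the
divergent coordinates (anomaly `∫_face Res · log ∂ₙΦ`, op. cit. §1.1) are NOT moves of this version.
[cite: DupontPanzerPym2026, Cor. 7.9] -/
def changeOfVariablesRel : Set FormalRep :=
  {c | ∃ (n : ℕ) (r r' : IntegralRep n) (Φ : Finset (Fin n) → (Fin n → ℝ) → (Fin n → ℝ))
      (Φ' : Finset (Fin n) → (Fin n → ℝ) → (Fin n → ℝ) →L[ℝ] (Fin n → ℝ)),
    r'.div = r.div ∧
    (∀ T, T ⊆ r.div →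
      IsSemialgebraicMapOn ℚ (cyl T r.domain) (Φ T) ∧
      (∀ x ∈ cyl T r.domain, HasFDerivWithinAt (Φ T) (Φ' T x) (cyl T r.domain) x) ∧
      InjOn (Φ T) (cyl T r.domain) ∧ cyl T r'.domain = Φ T '' cyl T r.domain ∧
      (∀ x ∈ cyl T r.domain, ∀ i ∈ r.div, Φ T x i = x i) ∧
      (∀ x ∈ cyl T r.domain, faceIntegrand r.num r.div T x =
        faceIntegrand r'.num r'.div T (Φ T x) * |(Φ' T x).det|)) ∧
    c = of r - of r'}

/-- **Move (d), regularised Newton–Leibniz along a NON-divergent last coordinate.** Data: a band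
representation `r` in dimension `n + 1` over a base representation `r'` in dimension `n` whose
divergent coordinates `D ⊆ Fin n` are those of `r` (embedded by `Fin.castSucc`; the last
coordinate is not divergent), and for every face `T ⊆ D` (including `T = ∅`): `ℚ`-semialgebraic
fibre bounds `a_T ≤ b_T` on the thickened face piece `cyl T τ` of the base such that the thickened
face piece of the band is the band `{(x,t) | x ∈ cyl T τ, a_T x ≤ t ≤ b_T x}`, and a
`ℚ`-semialgebraic primitive `F_T` on it, continuous on each closed fibre and with `t`-derivative
the face integrand of `r` on the open fibre, whose boundary values give the face integrand of `r'`: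
`f'_T(x) = F_T(x, b_T x) - F_T(x, a_T x)`. Then `[r] - [r']` is a relation: exactly
`KZ.newtonLeibnizRel` imposed on the representation and on each of its divergence faces (for
`D = ∅` it IS that move). Soundness is Fubini along the last coordinate applied to the subtracted
integrand plus the fundamental theorem of calculus on a.e. fibre — Dupont–Panzer–Pym's regularised
Stokes formula Cor. 7.11 in the case where the primitive has no pole along the boundary stratum
integrated over; Stokes ACROSS a divergence face (boundary term = regularised restriction) is not a
move of this version. [cite: DupontPanzerPym2026, Cor. 7.11] -/
def newtonLeibnizRel : Set FormalRep :=
  {c | ∃ (n : ℕ) (r : IntegralRep (n + 1)) (r' : IntegralRep n)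
      (a b : Finset (Fin n) → (Fin n → ℝ) → ℝ) (F : Finset (Fin n) → (Fin (n + 1) → ℝ) → ℝ),
    r.div = r'.div.map Fin.castSuccEmb ∧
    (∀ T, T ⊆ r'.div →
      IsSemialgebraicFunOn ℚ (cyl (T.map Fin.castSuccEmb) r.domain) (F T) ∧
      IsSemialgebraicFunOn ℚ (cyl T r'.domain) (a T) ∧
      IsSemialgebraicFunOn ℚ (cyl T r'.domain) (b T) ∧
      (∀ x ∈ cyl T r'.domain, a T x ≤ b T x) ∧
      cyl (T.map Fin.castSuccEmb) r.domain =
        {z | (Fin.init z : Fin n → ℝ) ∈ cyl T r'.domain ∧ a T (Fin.init z) ≤ z (Fin.last n) ∧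
          z (Fin.last n) ≤ b T (Fin.init z)} ∧
      (∀ x ∈ cyl T r'.domain,
        ContinuousOn (fun t : ℝ => F T (Fin.snoc x t)) (Icc (a T x) (b T x))) ∧
      (∀ x ∈ cyl T r'.domain, ∀ t ∈ Ioo (a T x) (b T x),
        HasDerivAt (fun s : ℝ => F T (Fin.snoc x s))
          (faceIntegrand r.num r.div (T.map Fin.castSuccEmb) (Fin.snoc x t)) t) ∧
      (∀ x ∈ cyl T r'.domain, faceIntegrand r'.num r'.div T x =
        F T (Fin.snoc x (b T x)) - F T (Fin.snoc x (a T x)))) ∧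
    c = of r - of r'}

/-- The subgroup of relations of the regularised calculus, generated by the four moves.
[cite: DupontPanzerPym2026, Cor. 7.9–7.11] -/
def relations : AddSubgroup FormalRep :=
  AddSubgroup.closure (domainAddRel ∪ integrandAddRel ∪ changeOfVariablesRel ∪ newtonLeibnizRel)

/-- Equivalence of regularised representations under the moves. [folklore] -/
def Equivalent (r : IntegralRep n) (r' : IntegralRep m) : Prop := of r - of r' ∈ relations

/-- Move (a) is a relation. [folklore] -/
theorem domainAddRel_subset_relations : domainAddRel ⊆ relations := fun _ hc =>
  AddSubgroup.subset_closure (Or.inl (Or.inl (Or.inl hc)))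

/-- Move (b) is a relation. [folklore] -/
theorem integrandAddRel_subset_relations : integrandAddRel ⊆ relations := fun _ hc =>
  AddSubgroup.subset_closure (Or.inl (Or.inl (Or.inr hc)))

/-- Move (c) is a relation. [folklore] -/
theorem changeOfVariablesRel_subset_relations : changeOfVariablesRel ⊆ relations := fun _ hc =>
  AddSubgroup.subset_closure (Or.inl (Or.inr hc))

/-- Move (d) is a relation. [folklore] -/
theorem newtonLeibnizRel_subset_relations : newtonLeibnizRel ⊆ relations := fun _ hc =>
  AddSubgroup.subset_closure (Or.inr hc)

namespace Equivalent

/-- Reflexivity. [folklore] -/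
@[refl] protected theorem refl (r : IntegralRep n) : Equivalent r r := by
  simp [Equivalent, relations.zero_mem]

/-- Symmetry. [folklore] -/
@[symm] protected theorem symm {r : IntegralRep n} {r' : IntegralRep m} (h : Equivalent r r') :
    Equivalent r' r := by
  simpa [Equivalent] using relations.neg_mem h

/-- Transitivity. [folklore] -/
@[trans] protected theorem trans {r : IntegralRep n} {r' : IntegralRep m} {r'' : IntegralRep l}
    (h : Equivalent r r') (h' : Equivalent r' r'') : Equivalent r r'' := by
  simpa [Equivalent] using relations.add_mem h h'

end Equivalent

/-- Relations are contained in the pull-back of a subgroup as soon as the four move sets are.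
[folklore] -/
theorem relations_le_comap {G : Type*} [AddCommGroup G] (φ : FormalRep →+ G) (K : AddSubgroup G)
    (h₁ : domainAddRel ⊆ φ ⁻¹' K) (h₂ : integrandAddRel ⊆ φ ⁻¹' K)
    (h₃ : changeOfVariablesRel ⊆ φ ⁻¹' K) (h₄ : newtonLeibnizRel ⊆ φ ⁻¹' K) :
    relations ≤ K.comap φ := by
  rw [relations]
  refine (AddSubgroup.closure_le _).2 ?_
  rintro x (((hx | hx) | hx) | hx)
  exacts [h₁ hx, h₂ hx, h₃ hx, h₄ hx]

/-! ### KZ moves are the `D = ∅` instances — `map_relations_le` -/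

/-- `incl` maps KZ domain-additivity relations to regularised ones (`D = ∅`). [folklore] -/
theorem incl_image_domainAddRel_subset : incl '' KZ.domainAddRel ⊆ domainAddRel := by
  rintro _ ⟨c, ⟨n, r, r₁, r₂, hdom, hvol, h₁, h₂, rfl⟩, rfl⟩
  refine ⟨n, ofKZ r, ofKZ r₁, ofKZ r₂, hdom, hvol, ?_, ?_, by simp [map_sub]⟩
  · intro x hx; simp [h₁ hx]
  · intro x hx; simp [h₂ hx]

/-- `incl` maps KZ integrand-additivity relations to regularised ones (`D = ∅`). [folklore] -/
theorem incl_image_integrandAddRel_subset : incl '' KZ.integrandAddRel ⊆ integrandAddRel := by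
  rintro _ ⟨c, ⟨n, r, r₁, r₂, h₁, h₂, hadd, rfl⟩, rfl⟩
  refine ⟨n, ofKZ r, ofKZ r₁, ofKZ r₂, h₁, h₂, ?_, by simp [map_sub]⟩
  intro x hx
  simpa using hadd hx

/-- `incl` maps KZ change-of-variables relations to regularised ones (`D = ∅`, only the face `T = ∅`). [folklore] -/
theorem incl_image_changeOfVariablesRel_subset :
    incl '' KZ.changeOfVariablesRel ⊆ changeOfVariablesRel := by
  rintro _ ⟨c, ⟨n, r, r', Φ, Φ', hΦ, hΦ', hinj, hdom, hf, rfl⟩, rfl⟩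
  refine ⟨n, ofKZ r, ofKZ r', fun _ => Φ, fun _ => Φ', rfl, fun T hT => ?_, by simp [map_sub]⟩
  obtain rfl : T = ∅ := Finset.subset_empty.1 hT
  simp only [ofKZ_domain, cyl_empty, ofKZ_div, Finset.notMem_empty, IsEmpty.forall_iff,
    implies_true, true_and, ofKZ_num]
  exact ⟨hΦ, hΦ', hinj, hdom, fun x hx => by simpa [faceIntegrand] using hf x hx⟩

/-- `incl` maps KZ Newton–Leibniz relations to regularised ones (`D = ∅`, only the face `T = ∅`). [folklore] -/
theorem incl_image_newtonLeibnizRel_subset : incl '' KZ.newtonLeibnizRel ⊆ newtonLeibnizRel := by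
  rintro _ ⟨c, ⟨n, r, r', a, b, F, hF, ha, hb, hab, hdom, hcont, hder, hr', rfl⟩, rfl⟩
  refine ⟨n, ofKZ r, ofKZ r', fun _ => a, fun _ => b, fun _ => F, by simp, fun T hT => ?_,
    by simp [map_sub]⟩
  obtain rfl : T = ∅ := Finset.subset_empty.1 hT
  simp only [Finset.map_empty, ofKZ_domain, cyl_empty, ofKZ_num, ofKZ_div]
  refine ⟨hF, ha, hb, hab, hdom, hcont, fun x hx t ht => ?_, fun x hx => ?_⟩
  · simpa [faceIntegrand] using hder x hx t ht
  · simpa [faceIntegrand] using hr' x hx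

/-- **`incl` maps KZ relations into regularised relations**: each of the four KZ move families is
the `D = ∅` instance of the corresponding regularised move. [cite: DupontPanzerPym2026, Prop. 7.15] -/
theorem map_relations_le : KZ.relations.map incl ≤ relations := by
  rw [KZ.relations, AddMonoidHom.map_closure]
  refine (AddSubgroup.closure_le _).2 ?_
  rintro _ ⟨c, hc, rfl⟩
  rcases hc with ((hc | hc) | hc) | hc
  · exact domainAddRel_subset_relations (incl_image_domainAddRel_subset ⟨c, hc, rfl⟩)
  · exact integrandAddRel_subset_relations (incl_image_integrandAddRel_subset ⟨c, hc, rfl⟩)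
  · exact changeOfVariablesRel_subset_relations
      (incl_image_changeOfVariablesRel_subset ⟨c, hc, rfl⟩)
  · exact newtonLeibnizRel_subset_relations (incl_image_newtonLeibnizRel_subset ⟨c, hc, rfl⟩)

/-- KZ-equivalent representations are equivalent in the regularised calculus. [folklore] -/
theorem Equivalent.of_kz {r : KZ.IntegralRep n} {r' : KZ.IntegralRep m} (h : KZ.Equivalent r r') :
    Equivalent (ofKZ r) (ofKZ r') := by
  have := map_relations_le ⟨_, h, rfl⟩
  simpa [Equivalent, map_sub] using this

/-! ### Soundness of the moves -/

/-- **Soundness of (a)**: by uniqueness of residues the regularised value is additive under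
a.e.-additive decompositions of the zero-extended integrand.
[cite: DupontPanzerPym2026, Cor. 7.9] -/
theorem eval_eq_zero_of_mem_domainAddRel {c : FormalRep} (hc : c ∈ domainAddRel) : eval c = 0 := by
  obtain ⟨n, r, r₁, r₂, hdom, hvol, h₁, h₂, rfl⟩ := hc
  simp only [map_sub, eval_of]
  rw [sub_sub, sub_eq_zero, IntegralRep.value_eq_regValue, IntegralRep.value_eq_regValue,
    IntegralRep.value_eq_regValue]
  refine IsResidueSystem.regValue_eq_add r.isResidueSystem r₁.isResidueSystem r₂.isResidueSystem ?_
  rw [IntegralRep.resSys_empty, IntegralRep.resSys_empty, IntegralRep.resSys_empty]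
  have hae : ∀ᵐ t ∂(volume : Measure (Fin n → ℝ)), t ∉ r₁.domain ∩ r₂.domain := by
    rw [ae_iff]; simpa using hvol
  filter_upwards [hae] with t ht
  simp only [Pi.add_apply]
  by_cases ht1 : t ∈ r₁.domain
  · have ht2 : t ∉ r₂.domain := fun h => ht ⟨ht1, h⟩
    have htr : t ∈ r.domain := by rw [hdom]; exact Or.inl ht1
    rw [indicator_of_mem htr, indicator_of_mem ht1, indicator_of_notMem ht2, add_zero, h₁ ht1]
  · by_cases ht2 : t ∈ r₂.domain
    · have htr : t ∈ r.domain := by rw [hdom]; exact Or.inr ht2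
      rw [indicator_of_mem htr, indicator_of_notMem ht1, indicator_of_mem ht2, zero_add, h₂ ht2]
    · have htr : t ∉ r.domain := by
        rw [hdom]; rintro (h | h) <;> contradiction
      rw [indicator_of_notMem htr, indicator_of_notMem ht1, indicator_of_notMem ht2, add_zero]

/-- **Soundness of (b)**: linearity of the regularised value in the integrand.
[cite: DupontPanzerPym2026, Thm.-Def. 1.5] -/
theorem eval_eq_zero_of_mem_integrandAddRel {c : FormalRep} (hc : c ∈ integrandAddRel) :
    eval c = 0 := by
  obtain ⟨n, r, r₁, r₂, h₁, h₂, hadd, rfl⟩ := hc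
  simp only [map_sub, eval_of]
  rw [sub_sub, sub_eq_zero, IntegralRep.value_eq_regValue, IntegralRep.value_eq_regValue,
    IntegralRep.value_eq_regValue]
  refine IsResidueSystem.regValue_eq_add r.isResidueSystem r₁.isResidueSystem r₂.isResidueSystem ?_
  rw [IntegralRep.resSys_empty, IntegralRep.resSys_empty, IntegralRep.resSys_empty, h₁, h₂]
  refine Filter.Eventually.of_forall fun t => ?_
  simp only [Pi.add_apply]
  by_cases ht : t ∈ r.domain
  · rw [indicator_of_mem ht, indicator_of_mem ht, indicator_of_mem ht]
    exact hadd ht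
  · simp [indicator_of_notMem ht]

namespace IntegralRep

/-- On a cutoff region at distance `ε` from all divergence faces, the divergence factor of a face
`T ⊆ D` is bounded below by `ε^{|T|}`. [folklore] -/
theorem abs_inv_divProd_le {D T : Finset (Fin n)} (hT : T ⊆ D) {ε : ℝ} (hε : 0 < ε)
    {t : Fin n → ℝ} (ht : t ∈ cutoff D ε) : |(divProd T t)⁻¹| ≤ (ε ^ T.card)⁻¹ := by
  rw [abs_inv]
  refine inv_anti₀ (pow_pos hε _) ?_
  rw [divProd, Finset.abs_prod, ← Finset.prod_const]
  exact Finset.prod_le_prod (fun _ _ => hε.le) fun i hi => ht i (hT hi)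

/-- Each residue divided by its own divergence factor is integrable on the cutoff regions (cutoff
lemma plus the bound `abs_inv_divProd_le`). [folklore] -/
theorem integrableOn_resSys_div (r : IntegralRep n) {T : Finset (Fin n)} (hT : T ⊆ r.div) {ε : ℝ}
    (hε : 0 < ε) : IntegrableOn (fun t => r.resSys T t / divProd T t) (cutoff r.div ε) := by
  have h1 : IntegrableOn (r.resSys T) (cutoff r.div ε) :=
    (r.isResidueSystem.integrableOn_cutoff hT hε).mono_set (cutoff_mono Finset.sdiff_subset ε)
  have h2 : IntegrableOn (fun t => (divProd T t)⁻¹ * r.resSys T t) (cutoff r.div ε) := by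
    refine Integrable.bdd_mul (c := (ε ^ T.card)⁻¹) h1
      (measurable_divProd T).inv.aestronglyMeasurable
      (ae_restrict_of_forall_mem (measurableSet_cutoff _ _) fun t ht => ?_)
    rw [Real.norm_eq_abs]
    exact abs_inv_divProd_le hT hε ht
  refine h2.congr_fun (fun t _ => ?_) (measurableSet_cutoff _ _)
  rw [div_eq_inv_mul]

/-- On a cutoff region the subtracted integrand splits into its finitely many (integrable) terms.
[folklore] -/
theorem setIntegral_subIntegrand_cutoff (r : IntegralRep n) {ε : ℝ} (hε : 0 < ε) :
    ∫ t in cutoff r.div ε, r.subIntegrand t =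
      ∑ T ∈ r.div.powerset, (-1 : ℝ) ^ T.card * ∫ t in cutoff r.div ε, r.resSys T t / divProd T t := by
  simp_rw [subIntegrand_apply, mul_div_assoc]
  rw [integral_finsetSum _ fun T hT => ?_]
  · exact Finset.sum_congr rfl fun T _ => integral_const_mul _ _
  · exact (r.integrableOn_resSys_div (Finset.mem_powerset.1 hT) hε).const_mul _

/-- The regularised value is the limit of the integrals of the subtracted integrand over the
cutoff regions `cutoff D (1/(k+1))` (exhaustion; their union has null complement). [folklore] -/
theorem tendsto_setIntegral_cutoff (r : IntegralRep n) :
    Tendsto (fun k : ℕ => ∫ t in cutoff r.div (1 / ((k : ℝ) + 1)), r.subIntegrand t) atTop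
      (𝓝 r.value) := by
  have hmono : Monotone fun k : ℕ => cutoff r.div (1 / ((k : ℝ) + 1)) := by
    intro k k' hkk' t ht j hj
    refine le_trans ?_ (ht j hj)
    exact one_div_le_one_div_of_le (by positivity) (by exact_mod_cast Nat.succ_le_succ hkk')
  have h := tendsto_setIntegral_of_monotone (fun k => measurableSet_cutoff r.div _) hmono
    r.integrable_subIntegrand.integrableOn
  convert h using 2
  rw [IntegralRep.value]
  refine (setIntegral_eq_integral_of_ae_compl_eq_zero ?_).symm
  filter_upwards [ae_forall_apply_ne_one r.div] with t ht hnot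
  exfalso
  obtain ⟨k, hk⟩ := exists_mem_cutoff r.div ht
  exact hnot (mem_iUnion.2 ⟨k, hk⟩)

end IntegralRep

/-- An indicator divided by a function is the indicator of the quotient. [folklore] -/
theorem indicator_div_eq {α : Type*} (C : Set α) (f g : α → ℝ) :
    (fun t => C.indicator f t / g t) = C.indicator fun t => f t / g t := by
  funext t
  by_cases ht : t ∈ C <;> simp [ht]

/-- **Soundness of (c)**: on every cutoff region each term of the subtracted integrand of `r` is
carried to the corresponding term of `r'` by the change of variables `Φ_T` on the thickened face
piece (Mathlib's Jacobian formula; `Φ_T` fixes the divergent coordinates, so it preserves the cutoff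
regions and the divergence factors), and the values are the limits over the exhaustion.
[cite: DupontPanzerPym2026, Cor. 7.9] -/
theorem eval_eq_zero_of_mem_changeOfVariablesRel {c : FormalRep} (hc : c ∈ changeOfVariablesRel) :
    eval c = 0 := by
  obtain ⟨n, r, r', Φ, Φ', hdiv, hT, rfl⟩ := hc
  simp only [map_sub, eval_of, sub_eq_zero]
  -- termwise equality of the cutoff integrals
  have hterm : ∀ {ε : ℝ}, 0 < ε → ∀ T ∈ r.div.powerset,
      ∫ t in cutoff r.div ε, r.resSys T t / divProd T t =
        ∫ t in cutoff r.div ε, r'.resSys T t / divProd T t := by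
    intro ε hε T hTD
    have hTD' : T ⊆ r.div := Finset.mem_powerset.1 hTD
    obtain ⟨-, hΦ', hinj, himg, hfix, hf⟩ := hT T hTD'
    have hcylm : MeasurableSet (cyl T r.domain) :=
      Literature.ModelTheory.ExponentialFields.IsSemialgebraic.measurableSet_holds
        (isSemialgebraic_cyl T r.isSemialgebraic_domain)
    have hcylm' : MeasurableSet (cyl T r'.domain) :=
      Literature.ModelTheory.ExponentialFields.IsSemialgebraic.measurableSet_holds
        (isSemialgebraic_cyl T r'.isSemialgebraic_domain)
    set S := cutoff r.div ε ∩ cyl T r.domain with hS_def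
    have hSm : MeasurableSet S := (measurableSet_cutoff _ _).inter hcylm
    have hSsub : S ⊆ cyl T r.domain := inter_subset_right
    -- the image of the cutoff face piece is the cutoff face piece
    have himgS : Φ T '' S = cutoff r.div ε ∩ cyl T r'.domain := by
      ext y
      constructor
      · rintro ⟨x, ⟨hxA, hxc⟩, rfl⟩
        refine ⟨fun j hj => ?_, himg ▸ ⟨x, hxc, rfl⟩⟩
        rw [hfix x hxc j hj]; exact hxA j hj
      · rintro ⟨hyA, hyc⟩
        rw [himg] at hyc
        obtain ⟨x, hxc, rfl⟩ := hyc
        refine ⟨x, ⟨fun j hj => ?_, hxc⟩, rfl⟩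
        rw [← hfix x hxc j hj]; exact hyA j hj
    rw [IntegralRep.resSys_apply, IntegralRep.resSys_apply, indicator_div_eq, indicator_div_eq,
      setIntegral_indicator hcylm, setIntegral_indicator hcylm', ← himgS,
      integral_image_eq_integral_abs_det_fderiv_smul volume hSm
        (fun x hx => (hΦ' x (hSsub hx)).mono hSsub) (hinj.mono hSsub)]
    refine setIntegral_congr_fun hSm fun x hx => ?_
    have hxc : x ∈ cyl T r.domain := hSsub hx
    have hdP : divProd T (Φ T x) = divProd T x := by
      simp only [divProd]
      exact Finset.prod_congr rfl fun i hi => by rw [hfix x hxc i (hTD' hi)]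
    rw [smul_eq_mul, hdP, hf x hxc]
    ring
  -- cutoff integrals of the subtracted integrands agree
  have hkey : ∀ k : ℕ, ∫ t in cutoff r.div (1 / ((k : ℝ) + 1)), r'.subIntegrand t =
      ∫ t in cutoff r.div (1 / ((k : ℝ) + 1)), r.subIntegrand t := by
    intro k
    have hε : (0 : ℝ) < 1 / ((k : ℝ) + 1) := by positivity
    have h1 := r'.setIntegral_subIntegrand_cutoff hε
    rw [hdiv] at h1
    rw [h1, r.setIntegral_subIntegrand_cutoff hε]
    exact Finset.sum_congr rfl fun T hTD => by rw [hterm hε T hTD]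
  have h' := r'.tendsto_setIntegral_cutoff
  rw [hdiv] at h'
  simp_rw [hkey] at h'
  exact tendsto_nhds_unique r.tendsto_setIntegral_cutoff h'

/-- Reindexing a sum over the subsets of an embedded finite set. [folklore] -/
theorem sum_powerset_map {α β M : Type*} [DecidableEq α] [DecidableEq β] [AddCommMonoid M]
    (e : α ↪ β) (D : Finset α) (f : Finset β → M) :
    ∑ T' ∈ (D.map e).powerset, f T' = ∑ T ∈ D.powerset, f (T.map e) := by
  symm
  refine Finset.sum_nbij' (fun T => T.map e) (fun T' => T'.preimage e e.injective.injOn)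
    (fun T hT => ?_) (fun T' hT' => ?_) (fun T _ => ?_) (fun T' hT' => ?_) (fun _ _ => rfl)
  · exact Finset.mem_powerset.2 (Finset.map_subset_map.2 (Finset.mem_powerset.1 hT))
  · rw [Finset.mem_powerset] at hT' ⊢
    intro x hx
    rw [Finset.mem_preimage] at hx
    simpa using hT' hx
  · ext x; simp
  · rw [Finset.mem_powerset] at hT'
    ext y
    simp only [Finset.mem_map, Finset.mem_preimage]
    constructor
    · rintro ⟨x, hx, rfl⟩; exact hx
    · intro hy
      obtain ⟨x, -, rfl⟩ := Finset.mem_map.1 (hT' hy)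
      exact ⟨x, hy, rfl⟩

/-- The divergence factor of an embedded face on a band point only sees the base. [folklore] -/
theorem divProd_map_snoc (T : Finset (Fin n)) (x : Fin n → ℝ) (t : ℝ) :
    divProd (T.map Fin.castSuccEmb) (Fin.snoc x t : Fin (n + 1) → ℝ) = divProd T x := by
  simp [divProd, Finset.prod_map]

/-- Cutoff regions of a band with non-divergent last coordinate are cylinders over cutoff regions of the base. [folklore] -/
theorem snoc_mem_cutoff_map {D : Finset (Fin n)} {ε : ℝ} {x : Fin n → ℝ} {t : ℝ} :
    (Fin.snoc x t : Fin (n + 1) → ℝ) ∈ cutoff (D.map Fin.castSuccEmb) ε ↔ x ∈ cutoff D ε := by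
  simp [cutoff]

/-- **Soundness of (d)**: Fubini along the last coordinate applied to the (integrable) subtracted
integrand of the band, whose fibre over a.e. base point `x` is the finite sum of the fibres of its
terms, each integrable (cutoff lemma) and each evaluated by the fundamental theorem of calculus on
the fibre `[a_T x, b_T x]` of the corresponding face band; the result is the subtracted integrand of
the base. [cite: DupontPanzerPym2026, Cor. 7.11] -/
theorem eval_eq_zero_of_mem_newtonLeibnizRel {c : FormalRep} (hc : c ∈ newtonLeibnizRel) :
    eval c = 0 := by
  obtain ⟨n, r, r', a, b, F, hdiv, hT, rfl⟩ := hc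
  simp only [map_sub, eval_of, sub_eq_zero]
  have hTsub : ∀ T ∈ r'.div.powerset, T.map Fin.castSuccEmb ⊆ r.div := fun T hTD => by
    rw [hdiv]; exact Finset.map_subset_map.2 (Finset.mem_powerset.1 hTD)
  obtain ⟨hfub, hae⟩ := KZexp.integral_eq_integral_integral_snoc r.integrable_subIntegrand
  rw [IntegralRep.value, hfub, IntegralRep.value]
  apply integral_congr_ae
  -- a.e. fibre integrability of each term of the subtracted integrand of the band
  have hfib : ∀ᵐ x : Fin n → ℝ ∂volume, ∀ T ∈ r'.div.powerset, ∀ k : ℕ,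
      x ∈ cutoff r'.div (1 / ((k : ℝ) + 1)) →
        Integrable (fun t : ℝ => r.resSys (T.map Fin.castSuccEmb) (Fin.snoc x t) /
          divProd (T.map Fin.castSuccEmb) (Fin.snoc x t : Fin (n + 1) → ℝ)) := by
    rw [Filter.eventually_all_finset]
    intro T hTD
    rw [ae_all_iff]
    intro k
    have hε : (0 : ℝ) < 1 / ((k : ℝ) + 1) := by positivity
    have hint := r.integrableOn_resSys_div (hTsub T hTD) hε
    set G : (Fin (n + 1) → ℝ) → ℝ := (cutoff r.div (1 / ((k : ℝ) + 1))).indicator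
      fun z => r.resSys (T.map Fin.castSuccEmb) z / divProd (T.map Fin.castSuccEmb) z with hG_def
    have hG : Integrable G := (integrable_indicator_iff (measurableSet_cutoff _ _)).2 hint
    obtain ⟨-, haeG⟩ := KZexp.integral_eq_integral_integral_snoc hG
    filter_upwards [haeG] with x hx hxA
    refine hx.congr (Filter.Eventually.of_forall fun t => ?_)
    have hmemA : (Fin.snoc x t : Fin (n + 1) → ℝ) ∈ cutoff r.div (1 / ((k : ℝ) + 1)) := by
      rw [hdiv]; exact snoc_mem_cutoff_map.2 hxA
    simp only [hG_def, indicator_of_mem hmemA]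
  filter_upwards [hae, hfib, ae_forall_apply_ne_one r'.div] with x _ hxfib hx1
  obtain ⟨k, hk⟩ := exists_mem_cutoff r'.div hx1
  have hfibT : ∀ T ∈ r'.div.powerset,
      Integrable (fun t : ℝ => r.resSys (T.map Fin.castSuccEmb) (Fin.snoc x t)) := by
    intro T hTD
    have h := (hxfib T hTD k hk).mul_const (divProd T x)
    refine h.congr (Filter.Eventually.of_forall fun t => ?_)
    simp only [divProd_map_snoc]
    rw [div_mul_cancel₀]
    exact divProd_ne_zero fun i hi => hx1 i (Finset.mem_powerset.1 hTD hi)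
  -- compute the fibre integral termwise
  simp_rw [IntegralRep.subIntegrand_apply]
  rw [hdiv]
  simp_rw [sum_powerset_map, Finset.card_map, divProd_map_snoc, mul_div_assoc]
  rw [integral_finsetSum _ fun T hTD => ((hfibT T hTD).div_const _).const_mul _]
  refine Finset.sum_congr rfl fun T hTD => ?_
  rw [integral_const_mul]
  congr 1
  rw [integral_div]
  congr 1
  -- the fibre of the face term: band structure and the fundamental theorem of calculus
  have hTD' : T ⊆ r'.div := Finset.mem_powerset.1 hTD
  obtain ⟨-, -, -, hab, hband, hcont, hder, hbd⟩ := hT T hTD'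
  have hmem : ∀ t : ℝ, (Fin.snoc x t : Fin (n + 1) → ℝ) ∈ cyl (T.map Fin.castSuccEmb) r.domain ↔
      x ∈ cyl T r'.domain ∧ t ∈ Icc (a T x) (b T x) := by
    intro t
    rw [hband]
    simp
  by_cases hx : x ∈ cyl T r'.domain
  · have hfun : (fun t : ℝ => r.resSys (T.map Fin.castSuccEmb) (Fin.snoc x t)) =
        (Icc (a T x) (b T x)).indicator fun t =>
          faceIntegrand r.num r.div (T.map Fin.castSuccEmb) (Fin.snoc x t) := by
      funext t
      rw [IntegralRep.resSys_apply]
      by_cases ht : t ∈ Icc (a T x) (b T x)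
      · rw [indicator_of_mem ((hmem t).2 ⟨hx, ht⟩), indicator_of_mem ht]
      · rw [indicator_of_notMem (fun h => ht ((hmem t).1 h).2), indicator_of_notMem ht]
    rw [hfun, integral_indicator measurableSet_Icc, integral_Icc_eq_integral_Ioc,
      ← intervalIntegral.integral_of_le (hab x hx), IntegralRep.resSys_apply, indicator_of_mem hx,
      hbd x hx]
    apply intervalIntegral.integral_eq_sub_of_hasDerivAt_of_le (hab x hx) (hcont x hx) (hder x hx)
    rw [intervalIntegrable_iff_integrableOn_Icc_of_le (hab x hx)]
    have hI := hfibT T hTD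
    rw [hfun] at hI
    exact (integrable_indicator_iff measurableSet_Icc).mp hI
  · have hfun : (fun t : ℝ => r.resSys (T.map Fin.castSuccEmb) (Fin.snoc x t)) = fun _ => 0 := by
      funext t
      rw [IntegralRep.resSys_apply, indicator_of_notMem (fun h => hx ((hmem t).1 h).1)]
    rw [hfun, integral_zero, IntegralRep.resSys_apply, indicator_of_notMem hx]

/-- **Soundness of the regularised calculus**: every relation evaluates to `0` (all four moves are
proved sound above). [cite: DupontPanzerPym2026, Cor. 7.9–7.11] -/
theorem relations_le_ker_eval : relations ≤ eval.ker := by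
  rw [relations]
  refine (AddSubgroup.closure_le _).mpr ?_
  rintro c (((hc | hc) | hc) | hc)
  · exact eval_eq_zero_of_mem_domainAddRel hc
  · exact eval_eq_zero_of_mem_integrandAddRel hc
  · exact eval_eq_zero_of_mem_changeOfVariablesRel hc
  · exact eval_eq_zero_of_mem_newtonLeibnizRel hc

/-- **The regularised value depends only on the zero-extended integrand a.e.** (for two
representations of the same dimension with arbitrary divergent coordinates): uniqueness of
residues. [folklore] -/
theorem IntegralRep.value_congr_ae {r r' : IntegralRep n}
    (h : r.domain.indicator r.integrand =ᵐ[volume] r'.domain.indicator r'.integrand) :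
    r.value = r'.value := by
  rw [IntegralRep.value_eq_regValue, IntegralRep.value_eq_regValue]
  refine IsResidueSystem.regValue_congr' r.isResidueSystem r'.isResidueSystem ?_
  rwa [IntegralRep.resSys_empty, IntegralRep.resSys_empty]

/-- Equivalent regularised representations have the same regularised value. [folklore] -/
theorem Equivalent.value_eq {r : IntegralRep n} {r' : IntegralRep m} (h : Equivalent r r') :
    r.value = r'.value := by
  have := relations_le_ker_eval h
  rwa [AddMonoidHom.mem_ker, map_sub, eval_of, eval_of, sub_eq_zero] at this

/-! ### The de-regularisation map `Λ : KZreg.FormalRep →+ KZ.FormalRep` -/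

/-- Finite sums of semialgebraic functions are semialgebraic. [folklore] -/
theorem _root_.Literature.NumberTheory.Transcendental.IsSemialgebraicFunOn.finset_sum {m : ℕ}
    {ι : Type*} (I : Finset ι) {s : Set (Fin m → ℝ)} (hs : IsSemialgebraic ℚ s)
    {f : ι → (Fin m → ℝ) → ℝ} (hf : ∀ i ∈ I, IsSemialgebraicFunOn ℚ s (f i)) :
    IsSemialgebraicFunOn ℚ s (fun t => ∑ i ∈ I, f i t) := by
  classical
  induction I using Finset.induction_on with
  | empty => simpa using (isSemialgebraicFunOn_aeval hs (0 : MvPolynomial (Fin m) ℚ))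
  | insert a I ha ih =>
    have h1 := hf a (Finset.mem_insert_self a I)
    have h2 := ih fun i hi => hf i (Finset.mem_insert_of_mem hi)
    have := IsSemialgebraicFunOn.add_holds h1 h2
    refine this.congr fun t _ => ?_
    simp [Finset.sum_insert ha]

/-- Two KZ representations with the same domain and integrand are equal. [folklore] -/
theorem kzIntegralRep_ext {r r' : KZ.IntegralRep n} (h1 : r.domain = r'.domain)
    (h2 : r.integrand = r'.integrand) : r = r' := by
  cases r; cases r'; cases h1; cases h2; rfl

namespace IntegralRep

variable (r : IntegralRep n)

/-- The thickened face pieces along the NONEMPTY faces, outside the domain: the part of the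
de-regularised domain where only counterterms are integrated. [folklore] -/
def outer : Set (Fin n → ℝ) := (⋃ T ∈ r.div.powerset.erase ∅, cyl T r.domain) \ r.domain

/-- The counterterms of the subtracted integrand: the terms of the nonempty faces,
`∑_{∅ ≠ T ⊆ D} (-1)^{|T|} 1_{cyl T σ} g(t[T:=1]) / Π_D`. [cite: DupontPanzerPym2026, Ex. 7.13] -/
def counterterm (t : Fin n → ℝ) : ℝ :=
  ∑ T ∈ r.div.powerset.erase ∅, (-1 : ℝ) ^ T.card * r.resSys T t / divProd T t

/-- The domain of the de-regularised representation: `σ` together with the thickened face pieces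
along the nonempty faces. [folklore] -/
def mainDomain : Set (Fin n → ℝ) := r.domain ∪ ⋃ T ∈ r.div.powerset.erase ∅, cyl T r.domain

/-- The integrand of the de-regularised representation: the integrand (dropped on `outer`, where
`t ∉ σ`) plus the counterterms; on `mainDomain` it is the subtracted integrand
(`mainIntegrand_eq_subIntegrand`), and for `D = ∅` it is literally the integrand. [folklore] -/
def mainIntegrand (t : Fin n → ℝ) : ℝ := r.outerᶜ.indicator r.integrand t + r.counterterm t

/-- The subtracted integrand is the zero-extended integrand plus the counterterms. [folklore] -/
theorem subIntegrand_eq_indicator_add_counterterm (t : Fin n → ℝ) :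
    r.subIntegrand t = r.domain.indicator r.integrand t + r.counterterm t := by
  rw [subIntegrand_apply, ← Finset.add_sum_erase _ _ (Finset.empty_mem_powerset r.div), counterterm,
    resSys_empty]
  simp

/-- The domain lies in the de-regularised domain. [folklore] -/
theorem domain_subset_mainDomain : r.domain ⊆ r.mainDomain := subset_union_left

/-- Points of the de-regularised domain outside `σ` lie in `outer`. [folklore] -/
theorem mem_outer_of_mem_mainDomain {t : Fin n → ℝ} (ht : t ∈ r.mainDomain) (hts : t ∉ r.domain) :
    t ∈ r.outer := by
  rcases ht with h | h
  · exact (hts h).elim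
  · exact ⟨h, hts⟩

/-- On the de-regularised domain the de-regularised integrand is the subtracted integrand. [folklore] -/
theorem mainIntegrand_eq_subIntegrand {t : Fin n → ℝ} (ht : t ∈ r.mainDomain) :
    r.mainIntegrand t = r.subIntegrand t := by
  rw [mainIntegrand, subIntegrand_eq_indicator_add_counterterm]
  congr 1
  by_cases hts : t ∈ r.domain
  · rw [indicator_of_mem hts, indicator_of_mem]
    exact fun h => h.2 hts
  · rw [indicator_of_notMem hts, indicator_of_notMem]
    exact fun h => h (r.mem_outer_of_mem_mainDomain ht hts)

/-- The subtracted integrand vanishes off the de-regularised domain. [folklore] -/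
theorem subIntegrand_eq_zero_of_not_mem_mainDomain {t : Fin n → ℝ} (ht : t ∉ r.mainDomain) :
    r.subIntegrand t = 0 := by
  refine r.subIntegrand_eq_zero fun T hT hmem => ht ?_
  by_cases hT0 : T = ∅
  · subst hT0
    exact Or.inl (by simpa using hmem)
  · exact Or.inr (mem_iUnion₂.2 ⟨T, Finset.mem_erase.2 ⟨hT0, hT⟩, hmem⟩)

/-- All divergent coordinates stay below `1` on the de-regularised domain. [folklore] -/
theorem lt_one_of_mem_mainDomain {t : Fin n → ℝ} (ht : t ∈ r.mainDomain) {i : Fin n}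
    (hi : i ∈ r.div) : t i < 1 := by
  rcases ht with h | h
  · exact r.lt_one t h i hi
  · obtain ⟨T, hT, hmem⟩ := mem_iUnion₂.1 h
    by_cases hiT : i ∈ T
    · exact (hmem.1 i hiT).2
    · exact r.lt_one_of_mem_cyl hmem hi hiT

/-- The de-regularised domain is `ℚ`-semialgebraic. [folklore] -/
theorem isSemialgebraic_mainDomain : IsSemialgebraic ℚ r.mainDomain :=
  r.isSemialgebraic_domain.union (IsSemialgebraic.biUnion _ _ fun T _ =>
    isSemialgebraic_cyl T r.isSemialgebraic_domain)

/-- `outer` is `ℚ`-semialgebraic. [folklore] -/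
theorem isSemialgebraic_outer : IsSemialgebraic ℚ r.outer :=
  (IsSemialgebraic.biUnion _ _ fun T _ => isSemialgebraic_cyl T r.isSemialgebraic_domain).diff
    r.isSemialgebraic_domain

/-- The integrand is `ℚ`-semialgebraic on the domain. [folklore] -/
theorem isSemialgebraicFunOn_integrand : IsSemialgebraicFunOn ℚ r.domain r.integrand := by
  have := r.isSemialgebraicFunOn_faceIntegrand (Finset.empty_subset r.div)
  rw [cyl_empty, faceIntegrand_empty] at this
  exact this

/-- The reciprocal divergence factors are `ℚ`-semialgebraic on the de-regularised domain.
[folklore] -/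
theorem isSemialgebraicFunOn_inv_divProd {T : Finset (Fin n)} (hT : T ⊆ r.div) :
    IsSemialgebraicFunOn ℚ r.mainDomain fun t => (divProd T t)⁻¹ := by
  have := isSemialgebraicFunOn_aeval_div_aeval r.isSemialgebraic_mainDomain 1
    (∏ i ∈ T, (1 - X i : MvPolynomial (Fin n) ℚ)) (fun t ht => ?_)
  · refine this.congr fun t _ => ?_
    beta_reduce
    rw [← divProd_eq_aeval]
    simp [one_div]
  · rw [← divProd_eq_aeval]
    exact divProd_ne_zero fun i hi => (r.lt_one_of_mem_mainDomain ht (hT hi)).ne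

/-- The de-regularised integrand is `ℚ`-semialgebraic on the de-regularised domain. [folklore] -/
theorem isSemialgebraicFunOn_mainIntegrand : IsSemialgebraicFunOn ℚ r.mainDomain r.mainIntegrand := by
  have hmain := r.isSemialgebraic_mainDomain
  -- the integrand part
  have h1 : IsSemialgebraicFunOn ℚ r.mainDomain (r.outerᶜ.indicator r.integrand) := by
    refine IsSemialgebraicFunOn.indicator hmain r.isSemialgebraic_outer.compl ?_
    have hsub : r.mainDomain ∩ r.outerᶜ ⊆ r.domain := by
      rintro t ⟨ht, hto⟩
      by_contra hts
      exact hto (r.mem_outer_of_mem_mainDomain ht hts)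
    exact r.isSemialgebraicFunOn_integrand.mono hsub (hmain.inter r.isSemialgebraic_outer.compl)
  -- the counterterms
  have h2 : IsSemialgebraicFunOn ℚ r.mainDomain r.counterterm := by
    refine IsSemialgebraicFunOn.finset_sum _ hmain fun T hT => ?_
    have hTD : T ⊆ r.div := Finset.mem_powerset.1 (Finset.mem_of_mem_erase hT)
    have hcyl := isSemialgebraic_cyl T r.isSemialgebraic_domain
    have hres : IsSemialgebraicFunOn ℚ r.mainDomain (r.resSys T) := by
      rw [resSys_apply]
      exact IsSemialgebraicFunOn.indicator hmain hcyl
        ((r.isSemialgebraicFunOn_faceIntegrand hTD).mono inter_subset_right (hmain.inter hcyl))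
    have hc : IsSemialgebraicFunOn ℚ r.mainDomain (fun _ => ((-1 : ℝ) ^ T.card)) :=
      (isSemialgebraicFunOn_aeval hmain (C ((-1 : ℚ) ^ T.card))).congr fun t _ => by simp
    have := IsSemialgebraicFunOn.mul_holds (IsSemialgebraicFunOn.mul_holds hc hres)
      (r.isSemialgebraicFunOn_inv_divProd hTD)
    refine this.congr fun t _ => ?_
    simp [div_eq_mul_inv]
  exact (IsSemialgebraicFunOn.add_holds h1 h2).congr fun t _ => rfl

/-- **The de-regularised representation** `mainPiece r : KZ.IntegralRep n`: the honest,
absolutely convergent KZ representation of the regularised value of `r`, with domain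
`σ ∪ ⋃_{∅ ≠ T ⊆ D} cyl T σ` and integrand the subtracted integrand (inclusion–exclusion subtraction
of the residues in the unit product collar of each divergence face; the stratified "finite part",
prototype: the forest-formula subtraction of Brown–Kreimer). For `D = ∅` it is `r` itself
(`mainPiece_ofKZ`). [cite: DupontPanzerPym2026, Ex. 7.13] [cite: BrownKreimer2013, Thm. 60] -/
def mainPiece : KZ.IntegralRep n where
  domain := r.mainDomain
  integrand := r.mainIntegrand
  isSemialgebraic_domain := r.isSemialgebraic_mainDomain
  isSemialgebraicFunOn_integrand := r.isSemialgebraicFunOn_mainIntegrand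
  integrableOn := by
    refine (r.integrable_subIntegrand.integrableOn.congr_fun (fun t ht => ?_)
      (Literature.ModelTheory.ExponentialFields.IsSemialgebraic.measurableSet_holds
        r.isSemialgebraic_mainDomain))
    exact (r.mainIntegrand_eq_subIntegrand ht).symm

/-- The domain of the de-regularised representation. [folklore] -/
@[simp] theorem mainPiece_domain : r.mainPiece.domain = r.mainDomain := rfl

/-- The integrand of the de-regularised representation. [folklore] -/
@[simp] theorem mainPiece_integrand : r.mainPiece.integrand = r.mainIntegrand := rfl

/-- **The de-regularised representation has the regularised value.**
[cite: DupontPanzerPym2026, Ex. 7.13] -/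
theorem value_mainPiece : r.mainPiece.value = r.value := by
  rw [KZ.IntegralRep.value, mainPiece_domain, mainPiece_integrand,
    setIntegral_congr_fun (Literature.ModelTheory.ExponentialFields.IsSemialgebraic.measurableSet_holds
      r.isSemialgebraic_mainDomain) (fun t ht => r.mainIntegrand_eq_subIntegrand ht),
    setIntegral_eq_integral_of_forall_compl_eq_zero
      (fun t ht => r.subIntegrand_eq_zero_of_not_mem_mainDomain ht)]
  rfl

end IntegralRep

/-- De-regularising an ordinary representation gives it back, on the nose. [folklore] -/
theorem mainPiece_ofKZ (r : KZ.IntegralRep n) : (ofKZ r).mainPiece = r := by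
  refine kzIntegralRep_ext ?_ ?_
  · simp [IntegralRep.mainPiece, IntegralRep.mainDomain]
  · funext t
    simp [IntegralRep.mainPiece, IntegralRep.mainIntegrand, IntegralRep.outer,
      IntegralRep.counterterm]

/-- **The de-regularisation map `Λ`** (route Deregularisation): the additive map sending a
regularised representation to its de-regularised, absolutely convergent KZ representation
`[mainPiece r]` (product-collar subtraction of the residues, with zero extension off the domain).
With unit tangential data no anomaly/constant representations occur. [cite: DupontPanzerPym2026, Ex. 7.13] [cite: BrownKreimer2013, Thm. 60] -/
def Λ : FormalRep →+ KZ.FormalRep := FreeAbelianGroup.lift fun r => KZ.of r.2.mainPiece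

/-- `Λ` on generators. [folklore] -/
@[simp] theorem Λ_of (r : IntegralRep n) : Λ (of r) = KZ.of r.mainPiece :=
  FreeAbelianGroup.lift_apply_of _ _

/-- **`Λ` is a retraction of `incl`**: `Λ (incl c) = c`. [folklore] -/
theorem Λ_incl (c : KZ.FormalRep) : Λ (incl c) = c := by
  suffices h : Λ.comp incl = AddMonoidHom.id _ from DFunLike.congr_fun h c
  refine FreeAbelianGroup.lift_ext _ _ ?_
  rintro ⟨n, r⟩
  change Λ (incl (KZ.of r)) = KZ.of r
  rw [incl_of, Λ_of, mainPiece_ofKZ]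

/-- **`Λ` preserves values**: `KZ.eval (Λ d) = eval d`. [cite: DupontPanzerPym2026, Ex. 7.13] -/
theorem eval_Λ (d : FormalRep) : KZ.eval (Λ d) = eval d := by
  have hgen : ∀ r : Σ n, IntegralRep n,
      KZ.eval (Λ (FreeAbelianGroup.of r)) = eval (FreeAbelianGroup.of r) := by
    rintro ⟨n, r⟩
    change KZ.eval (Λ (of r)) = eval (of r)
    rw [Λ_of, KZ.eval_of, eval_of, IntegralRep.value_mainPiece]
  induction d using FreeAbelianGroup.induction_on with
  | zero => simp
  | of r => exact hgen r
  | neg r ih => rw [map_neg, map_neg, map_neg, hgen r]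
  | add a b ha hb => simp [map_add, ha, hb]

/-- The REGULARISATION DEFECT of a representation: `[r] - incl (Λ [r])`, a formal combination of
regularised value `0` relating `r` to its de-regularisation. [folklore] -/
def regDefect (r : IntegralRep n) : FormalRep := of r - incl (Λ (of r))

/-- Regularisation defects have regularised value `0`. [folklore] -/
theorem eval_regDefect (r : IntegralRep n) : eval (regDefect r) = 0 := by
  rw [regDefect, map_sub, eval_incl, eval_Λ, sub_self]

/-! ### Open statements and the sandwich around `Conservative` -/

/-- OPEN STATEMENT — **`KZreg.KernelConjecture`** (route Deregularisation, item RegKernel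
stmt-KontsevichZagierPeriods-4954, "standing summit-strength hypothesis"): every formal
`ℤ`-combination of regularised representations of regularised value `0` is a relation of the
regularised calculus, `ker eval = relations` (the inclusion `relations ≤ ker eval` is
`relations_le_ker_eval`, proved). Posed by the route, stated in no source; with `Conservative` it
implies the ordinary kernel conjecture (`kzKernelConjecture_of_conservative`). It also asserts that
every regularisation defect `regDefect r` (value `0`) is a relation, which the four moves of this
version do not obviously provide. Registered as an open statement (CONVENTIONS §4), to be used only
as a hypothesis. [folklore] [status: open] -/
@[conjecture] def KernelConjecture : Prop :=
  ∀ d : FormalRep, eval d = 0 → d ∈ relations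

/-- OPEN STATEMENT — **`KZreg.Conservative`** (route Deregularisation, crux RegConservative
stmt-KontsevichZagierPeriods-4952): the de-regularisation `Λ` maps relations of the regularised
calculus to relations of the ordinary Kontsevich–Zagier calculus. In the tree it follows from the
ordinary kernel conjecture (`conservative_of_kzKernelConjecture`, via soundness and `eval_Λ`), and
together with `KernelConjecture` it implies it (`kzKernelConjecture_of_conservative`); the route's
thesis is that it holds BY BOOKKEEPING except at `u`-dependent shears (`changeOfVariablesRel` with
`Φ_∅` depending on the divergent coordinates), whose `Λ`-defects are the scaling-defect identities
of the Theses file. Stated in no source; registered as an open statement (CONVENTIONS §4).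
[folklore] [status: open] -/
def Conservative : Prop :=
  ∀ d ∈ relations, Λ d ∈ KZ.relations

/-- `Conservative` says that the relations lie in the pull-back of the KZ relations along `Λ`.
[folklore] -/
theorem conservative_iff_le_comap : Conservative ↔ relations ≤ KZ.relations.comap Λ :=
  Iff.rfl

/-- Under `Conservative` and `KernelConjecture` the ordinary kernel conjecture follows: for
`c ∈ KZ.FormalRep` with `KZ.eval c = 0`, `incl c` has regularised value `0`, hence is a relation,
hence `c = Λ (incl c)` is a KZ relation. This is the instance `L := KZreg.FormalRep` of the route's
`DeregularisationShell` (`Λ_incl`, `eval_incl`). [folklore] -/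
theorem kzKernelConjecture_of_conservative (hc : Conservative) (hk : KernelConjecture) :
    Transcendental.KZKernelConjecture := by
  intro c h0
  have h1 : incl c ∈ relations := hk _ (by rw [eval_incl]; exact h0)
  have := hc _ h1
  rwa [Λ_incl] at this

/-- The `Λ`-image of a relation has KZ value `0` (soundness and `eval_Λ`). [folklore] -/
theorem kz_eval_Λ_eq_zero {d : FormalRep} (hd : d ∈ relations) : KZ.eval (Λ d) = 0 := by
  rw [eval_Λ]
  exact relations_le_ker_eval hd

/-- **`Conservative` follows from the ordinary kernel conjecture.** [folklore] -/
theorem conservative_of_kzKernelConjecture (hk : Transcendental.KZKernelConjecture) : Conservative :=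
  fun _ hd => hk _ (kz_eval_Λ_eq_zero hd)

/-- Retraction criterion on generators: `Conservative` holds as soon as `Λ` maps each of the four
move sets into `KZ.relations`. [folklore] -/
theorem Conservative.of_subset (h₁ : domainAddRel ⊆ Λ ⁻¹' KZ.relations)
    (h₂ : integrandAddRel ⊆ Λ ⁻¹' KZ.relations) (h₃ : changeOfVariablesRel ⊆ Λ ⁻¹' KZ.relations)
    (h₄ : newtonLeibnizRel ⊆ Λ ⁻¹' KZ.relations) : Conservative :=
  fun _ hd => relations_le_comap Λ KZ.relations h₁ h₂ h₃ h₄ hd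

/-! ### Worked example: `reg ∫₀¹ dt/(1 - t) = 0` (the unit scale) -/

/-- The open unit interval in `ℝ¹`. [folklore] -/
def unitIoo : Set (Fin 1 → ℝ) := {t | 0 < t 0 ∧ t 0 < 1}

/-- The open unit interval is `ℚ`-semialgebraic. [folklore] -/
theorem isSemialgebraic_unitIoo : IsSemialgebraic ℚ unitIoo := by
  have h1 := isSemialgebraic_setOf_eval_pos (k := ℚ) (R := ℝ) (X 0 : MvPolynomial (Fin 1) ℚ)
  have h2 := isSemialgebraic_setOf_eval_lt (k := ℚ) (R := ℝ) (X 0 : MvPolynomial (Fin 1) ℚ) 1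
  convert h1.inter h2 using 1
  ext t
  simp [unitIoo]

/-- In `ℝ¹` the face map of `{0}` is constant, so the thickened face piece of the unit interval is
the unit interval. [folklore] -/
theorem cyl_zero_unitIoo : cyl {0} unitIoo = unitIoo := by
  ext t
  rw [mem_cyl_iff]
  simp only [Finset.mem_singleton, forall_eq, mem_Ioo, unitIoo, mem_setOf_eq]
  constructor
  · rintro ⟨h, -⟩; exact h
  · intro h
    refine ⟨h, fun _ => 1 / 2, by norm_num, ?_⟩
    funext i
    fin_cases i
    simp [faceMap]

/-- **The unit pole** `[(0,1), 1/(1 - t); D = {0}]`: the simplest divergent regularised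
representation. Its subtracted integrand is `1_{(0,1)}/(1-t) - 1_{(0,1)}·1/(1-t) = 0`.
[cite: DupontPanzerPym2026, Ex. 7.13] -/
def unitPole : IntegralRep 1 where
  domain := unitIoo
  num := fun _ => 1
  div := {0}
  lt_one t ht i hi := by
    rw [Finset.mem_singleton] at hi
    subst hi
    exact ht.2
  isSemialgebraic_domain := isSemialgebraic_unitIoo
  isSemialgebraicFunOn_num T _ :=
    (isSemialgebraicFunOn_aeval (isSemialgebraic_faceImage T isSemialgebraic_unitIoo) 1).congr
      fun t _ => by simp
  integrable_rem S hS := by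
    rcases Finset.subset_singleton_iff.1 hS with rfl | rfl
    · -- the subtracted integrand vanishes identically
      have : rem {0} (resSys unitIoo (fun _ => (1 : ℝ)) {0}) ∅ = 0 := by
        funext t
        rw [rem]
        have hps : (({0} : Finset (Fin 1)) \ ∅).powerset = {∅, {0}} := by decide
        rw [hps, Finset.sum_pair (by decide)]
        simp only [Finset.card_empty, pow_zero, Finset.empty_union, divProd_empty, div_one, one_mul,
          Finset.card_singleton, pow_one, resSys, cyl_empty, cyl_zero_unitIoo, Pi.zero_apply]
        by_cases ht : t ∈ unitIoo
        · simp only [indicator_of_mem ht, faceIntegrand, divProd, Finset.sdiff_empty,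
            Finset.prod_singleton, Finset.sdiff_self, Finset.prod_empty]
          ring
        · simp [indicator_of_notMem ht]
      rw [this]
      exact integrable_zero _ _ _
    · -- the residue along the face: the indicator of the unit interval
      have : rem {0} (resSys unitIoo (fun _ => (1 : ℝ)) {0}) {0} = unitIoo.indicator 1 := by
        funext t
        simp only [rem, Finset.sdiff_self, Finset.powerset_empty, Finset.sum_singleton,
          Finset.card_empty, pow_zero, Finset.union_empty, divProd_empty, div_one, one_mul, resSys,
          cyl_zero_unitIoo]
        by_cases ht : t ∈ unitIoo
        · simp [indicator_of_mem ht, faceIntegrand]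
        · simp [indicator_of_notMem ht]
      rw [this, integrable_indicator_iff
        (Literature.ModelTheory.ExponentialFields.IsSemialgebraic.measurableSet_holds
          isSemialgebraic_unitIoo)]
      refine integrableOn_const ?_
      refine (measure_mono (fun t (ht : t ∈ unitIoo) => ?_ : unitIoo ⊆ Icc 0 1)).trans_lt ?_ |>.ne
      · exact ⟨fun i => by fin_cases i; exact ht.1.le, fun i => by fin_cases i; exact ht.2.le⟩
      · rw [Real.volume_Icc_pi]; simp

/-- **`reg ∫₀¹ dt/(1-t) = 0`**: the regularised value of the unit pole with the unit scale vanishes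
(Dupont–Panzer–Pym Ex. 7.13 with `a = λ = 1`: `log(a/λ) = 0`). [cite: DupontPanzerPym2026, Ex. 7.13] -/
theorem value_unitPole : unitPole.value = 0 := by
  have : unitPole.subIntegrand = 0 := by
    funext t
    rw [IntegralRep.subIntegrand, IntegralRep.resSys]
    change rem {0} (resSys unitIoo (fun _ => (1 : ℝ)) {0}) ∅ t = 0
    rw [rem]
    have hps : (({0} : Finset (Fin 1)) \ ∅).powerset = {∅, {0}} := by decide
    rw [hps, Finset.sum_pair (by decide)]
    simp only [Finset.card_empty, pow_zero, Finset.empty_union, divProd_empty, div_one, one_mul,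
      Finset.card_singleton, pow_one, resSys, cyl_empty, cyl_zero_unitIoo]
    by_cases ht : t ∈ unitIoo
    · simp only [indicator_of_mem ht, faceIntegrand, divProd, Finset.sdiff_empty,
        Finset.prod_singleton, Finset.sdiff_self, Finset.prod_empty]
      ring
    · simp [indicator_of_notMem ht]
  rw [IntegralRep.value, this]
  simp

/-! ### The cutoff expansion: explicit `log ε` counterterms

On a cutoff region the term of the face `T` of the subtracted integrand FACTORISES (Fubini over the
unit collar of each coordinate of `T`) as `(-log ε)^{|T|}` times the cutoff integral of the face;
hence the regularised value is the limit of `∑_T (log ε)^{|T|} I_T(ε)`, `I_T(ε)` the ordinary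
integral of the face integrand over the face piece cut off at distance `ε` from its own divergence
faces — the classical recipe "subtract the divergent powers of `log ε`", with explicit coefficients. -/

/-- `∫_{0 < s ≤ 1-ε} ds/(1-s) = -log ε` for `0 < ε ≤ 1`. [folklore] -/
theorem integral_indicator_inv_one_sub {ε : ℝ} (hε : 0 < ε) (hε1 : ε ≤ 1) :
    ∫ s, ({s : ℝ | ε ≤ |1 - s|} ∩ Ioo 0 1).indicator (fun s => (1 - s)⁻¹) s = -Real.log ε := by
  have hset : ({s : ℝ | ε ≤ |1 - s|} ∩ Ioo 0 1) = Ioc 0 (1 - ε) := by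
    ext s
    simp only [mem_inter_iff, mem_setOf_eq, mem_Ioo, mem_Ioc]
    constructor
    · rintro ⟨h1, h2, h3⟩
      rw [abs_of_pos (by linarith)] at h1
      exact ⟨h2, by linarith⟩
    · rintro ⟨h1, h2⟩
      refine ⟨?_, h1, by linarith⟩
      rw [abs_of_pos (by linarith)]
      linarith
  rw [hset, integral_indicator measurableSet_Ioc, ← intervalIntegral.integral_of_le (by linarith),
    intervalIntegral.integral_comp_sub_left (fun x : ℝ => x⁻¹) 1]
  norm_num
  rw [integral_inv_of_pos hε one_pos, one_div, Real.log_inv]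

/-- **One collar integration.** For a `{i}`-cylindrical `φ` (`i ∈ D`) the cutoff
integral of `φ/(1 - tᵢ)` over `cutoff D ε` is `-log ε` times the cutoff integral of `φ` over
`cutoff (D.erase i) ε` (Fubini along the coordinate `i`; unit thickness of the collar).
[folklore] -/
theorem setIntegral_cutoff_div_one_sub {m : ℕ} (i : Fin (m + 1)) {D : Finset (Fin (m + 1))}
    (hi : i ∈ D) {φ : (Fin (m + 1) → ℝ) → ℝ} (hφ : IsCylindrical {i} φ)
    {ε : ℝ} (hε : 0 < ε) (hε1 : ε ≤ 1)
    (hint : IntegrableOn (fun t => φ t / (1 - t i)) (cutoff D ε))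
    (hint' : IntegrableOn φ (cutoff (D.erase i) ε)) :
    ∫ t in cutoff D ε, φ t / (1 - t i) = -Real.log ε * ∫ t in cutoff (D.erase i) ε, φ t := by
  set e : (Fin (m + 1) → ℝ) ≃ᵐ ℝ × (Fin m → ℝ) :=
    MeasurableEquiv.piFinSuccAbove (fun _ => ℝ) i with he_def
  have he : MeasurePreserving e volume volume := volume_preserving_piFinSuccAbove (fun _ => ℝ) i
  have he_symm : ∀ p : ℝ × (Fin m → ℝ), e.symm p = Fin.insertNth i p.1 p.2 := fun p => by
    simp [he_def, MeasurableEquiv.piFinSuccAbove_symm_apply, Fin.insertNthEquiv]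
  have he_upd : ∀ (s s' : ℝ) (y : Fin m → ℝ), e.symm (s', y) = Function.update (e.symm (s, y)) i s' := by
    intro s s' y; rw [he_symm, he_symm]; simp
  have he_apply : ∀ (s : ℝ) (y : Fin m → ℝ), e.symm (s, y) i = s := by
    intro s y; rw [he_symm]; simp
  have he_apply_ne : ∀ (s s' : ℝ) (y : Fin m → ℝ) (j : Fin (m + 1)), j ≠ i →
      e.symm (s, y) j = e.symm (s', y) j := by
    intro s s' y j hj
    rw [he_upd s' s y, Function.update_of_ne hj]
  have hi1 : i ∈ ({i} : Finset (Fin (m + 1))) := Finset.mem_singleton_self i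
  -- membership in the cutoff regions along the fibres
  have hmemD : ∀ (s : ℝ) (y : Fin m → ℝ), e.symm (s, y) ∈ cutoff D ε ↔
      ε ≤ |1 - s| ∧ e.symm (1 / 2, y) ∈ cutoff (D.erase i) ε := by
    intro s y
    constructor
    · intro h
      refine ⟨by simpa [he_apply] using h i hi, fun j hj => ?_⟩
      rw [Finset.mem_erase] at hj
      rw [← he_apply_ne s (1 / 2) y j hj.1]
      exact h j hj.2
    · rintro ⟨hs, hy⟩ j hj
      by_cases hji : j = i
      · subst hji; simpa [he_apply] using hs
      · rw [he_apply_ne s (1 / 2) y j hji]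
        exact hy j (Finset.mem_erase.2 ⟨hji, hj⟩)
  have hmemD' : ∀ (s : ℝ) (y : Fin m → ℝ), e.symm (s, y) ∈ cutoff (D.erase i) ε ↔
      e.symm (1 / 2, y) ∈ cutoff (D.erase i) ε := by
    intro s y
    constructor
    · intro h j hj
      rw [← he_apply_ne s (1 / 2) y j (Finset.mem_erase.1 hj).1]; exact h j hj
    · intro h j hj
      rw [he_apply_ne s (1 / 2) y j (Finset.mem_erase.1 hj).1]; exact h j hj
  have hφ_eq : ∀ (s : ℝ) (y : Fin m → ℝ), φ (e.symm (s, y)) =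
      (Ioo (0 : ℝ) 1).indicator (fun _ => φ (e.symm (1 / 2, y))) s := by
    intro s y
    rw [he_upd (1 / 2) s y, hφ.apply_update hi1]
    by_cases hs : s ∈ Ioo (0 : ℝ) 1
    · rw [indicator_of_mem hs, indicator_of_mem hs]
      congr 1
      rw [← he_upd]
    · rw [indicator_of_notMem hs, indicator_of_notMem hs]
  -- the common section
  set c : (Fin m → ℝ) → ℝ := fun y => (cutoff (D.erase i) ε).indicator φ (e.symm (1 / 2, y))
    with hc_def
  -- left-hand side
  set FL : (Fin (m + 1) → ℝ) → ℝ := (cutoff D ε).indicator fun t => φ t / (1 - t i) with hFL_def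
  have hFL : Integrable FL := (integrable_indicator_iff (measurableSet_cutoff _ _)).2 hint
  have hFL2 : Integrable (fun p => FL (e.symm p))
      ((volume : Measure ℝ).prod (volume : Measure (Fin m → ℝ))) := by
    rw [← Measure.volume_eq_prod]
    exact ((he.symm e).integrable_comp_emb e.symm.measurableEmbedding).mpr hFL
  have hpointL : ∀ (s : ℝ) (y : Fin m → ℝ), FL (e.symm (s, y)) =
      c y * ({s : ℝ | ε ≤ |1 - s|} ∩ Ioo 0 1).indicator (fun s => (1 - s)⁻¹) s := by
    intro s y
    simp only [hFL_def, hc_def]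
    by_cases hyA : e.symm (1 / 2, y) ∈ cutoff (D.erase i) ε
    · rw [indicator_of_mem hyA]
      by_cases hs : ε ≤ |1 - s|
      · rw [indicator_of_mem ((hmemD s y).2 ⟨hs, hyA⟩), he_apply, hφ_eq s y]
        by_cases hs' : s ∈ Ioo (0 : ℝ) 1
        · rw [indicator_of_mem hs',
            indicator_of_mem (show s ∈ {s : ℝ | ε ≤ |1 - s|} ∩ Ioo 0 1 from ⟨hs, hs'⟩),
            div_eq_mul_inv]
        · rw [indicator_of_notMem hs', indicator_of_notMem (fun h => hs' h.2)]; simp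
      · rw [indicator_of_notMem (fun h => hs ((hmemD s y).1 h).1),
          indicator_of_notMem (fun h => hs h.1)]; simp
    · rw [indicator_of_notMem (fun h => hyA ((hmemD s y).1 h).2), indicator_of_notMem hyA]; simp
  have hL : ∫ t in cutoff D ε, φ t / (1 - t i) = -Real.log ε * ∫ y, c y := by
    calc ∫ t in cutoff D ε, φ t / (1 - t i) = ∫ t, FL t :=
          (integral_indicator (measurableSet_cutoff _ _)).symm
      _ = ∫ p, FL (e.symm p) ∂((volume : Measure ℝ).prod (volume : Measure (Fin m → ℝ))) := by
          rw [← Measure.volume_eq_prod]; exact ((he.symm e).integral_comp' FL).symm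
      _ = ∫ y, ∫ s, FL (e.symm (s, y)) := integral_prod_symm _ hFL2
      _ = ∫ y, -Real.log ε * c y := by
          refine integral_congr_ae (Filter.Eventually.of_forall fun y => ?_)
          simp_rw [hpointL]
          rw [integral_const_mul, integral_indicator_inv_one_sub hε hε1, mul_comm]
      _ = -Real.log ε * ∫ y, c y := integral_const_mul _ _
  -- right-hand side
  set FR : (Fin (m + 1) → ℝ) → ℝ := (cutoff (D.erase i) ε).indicator φ with hFR_def
  have hFR : Integrable FR := (integrable_indicator_iff (measurableSet_cutoff _ _)).2 hint'
  have hFR2 : Integrable (fun p => FR (e.symm p))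
      ((volume : Measure ℝ).prod (volume : Measure (Fin m → ℝ))) := by
    rw [← Measure.volume_eq_prod]
    exact ((he.symm e).integrable_comp_emb e.symm.measurableEmbedding).mpr hFR
  have hpointR : ∀ (s : ℝ) (y : Fin m → ℝ), FR (e.symm (s, y)) =
      c y * (Ioo (0 : ℝ) 1).indicator (fun _ => (1 : ℝ)) s := by
    intro s y
    simp only [hFR_def, hc_def]
    by_cases hyA : e.symm (1 / 2, y) ∈ cutoff (D.erase i) ε
    · rw [indicator_of_mem ((hmemD' s y).2 hyA), indicator_of_mem hyA, hφ_eq s y]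
      by_cases hs' : s ∈ Ioo (0 : ℝ) 1
      · rw [indicator_of_mem hs', indicator_of_mem hs', mul_one]
      · rw [indicator_of_notMem hs', indicator_of_notMem hs', mul_zero]
    · rw [indicator_of_notMem (fun h => hyA ((hmemD' s y).1 h)), indicator_of_notMem hyA, zero_mul]
  have hR : ∫ t in cutoff (D.erase i) ε, φ t = ∫ y, c y := by
    calc ∫ t in cutoff (D.erase i) ε, φ t = ∫ t, FR t :=
          (integral_indicator (measurableSet_cutoff _ _)).symm
      _ = ∫ p, FR (e.symm p) ∂((volume : Measure ℝ).prod (volume : Measure (Fin m → ℝ))) := by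
          rw [← Measure.volume_eq_prod]; exact ((he.symm e).integral_comp' FR).symm
      _ = ∫ y, ∫ s, FR (e.symm (s, y)) := integral_prod_symm _ hFR2
      _ = ∫ y, c y := by
          refine integral_congr_ae (Filter.Eventually.of_forall fun y => ?_)
          simp_rw [hpointR]
          rw [integral_const_mul, integral_indicator_const _ measurableSet_Ioo]
          simp
  rw [hL, hR]

/-- **Collar factorisation.** For a `T`-cylindrical `ψ` (`T ⊆ D`), with the relevant
quotients integrable on the relevant cutoff regions, the cutoff integral of `ψ/Π_T` over
`cutoff D ε` is `(-log ε)^{|T|}` times the cutoff integral of `ψ` over `cutoff (D \ T) ε`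
(iterate `setIntegral_cutoff_div_one_sub` over the coordinates of `T`). [folklore] -/
theorem setIntegral_cutoff_div_divProd {ε : ℝ} (hε : 0 < ε) (hε1 : ε ≤ 1) {ψ : (Fin n → ℝ) → ℝ}
    (T : Finset (Fin n)) :
    ∀ D : Finset (Fin n), T ⊆ D → IsCylindrical T ψ →
      (∀ U, U ⊆ T → IntegrableOn (fun t => ψ t / divProd U t) (cutoff ((D \ T) ∪ U) ε)) →
      ∫ t in cutoff D ε, ψ t / divProd T t =
        (-Real.log ε) ^ T.card * ∫ t in cutoff (D \ T) ε, ψ t := by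
  induction T using Finset.induction_on with
  | empty =>
    intro D _ _ _
    simp
  | insert i T₀ hi ih =>
    intro D hTD hcyl hint
    obtain ⟨m, rfl⟩ : ∃ m, n = m + 1 := ⟨n - 1, by have := i.pos; omega⟩
    have hiD : i ∈ D := hTD (Finset.mem_insert_self i T₀)
    have hT₀D : T₀ ⊆ D.erase i := fun j hj =>
      Finset.mem_erase.2 ⟨fun h => hi (h ▸ hj), hTD (Finset.mem_insert_of_mem hj)⟩
    -- the function `ψ/Π_{T₀}` is `{i}`-cylindrical
    set φ : (Fin (m + 1) → ℝ) → ℝ := fun t => ψ t / divProd T₀ t with hφ_def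
    have hφc : IsCylindrical {i} φ := by
      refine ⟨fun t ht j hj => ?_, fun t j hj s hs htj => ?_⟩
      · rw [Finset.mem_singleton] at hj; subst hj
        have : ψ t ≠ 0 := fun h => ht (by simp [hφ_def, h])
        exact hcyl.1 t this j (Finset.mem_insert_self j T₀)
      · rw [Finset.mem_singleton] at hj; subst hj
        simp only [hφ_def]
        rw [hcyl.2 t j (Finset.mem_insert_self j T₀) s hs htj, divProd_update_of_not_mem hi]
    have hset1 : (D \ insert i T₀) ∪ insert i T₀ = D := Finset.sdiff_union_of_subset hTD
    have hset2 : (D \ insert i T₀) ∪ T₀ = D.erase i := by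
      ext j
      simp only [Finset.mem_union, Finset.mem_sdiff, Finset.mem_insert, Finset.mem_erase]
      constructor
      · rintro (⟨hjD, hj⟩ | hj)
        · exact ⟨fun h => hj (Or.inl h), hjD⟩
        · exact ⟨fun h => hi (h ▸ hj), (hT₀D hj) |> Finset.mem_of_mem_erase⟩
      · rintro ⟨hji, hjD⟩
        by_cases hj : j ∈ T₀
        · exact Or.inr hj
        · exact Or.inl ⟨hjD, fun h => h.elim hji hj⟩
    -- first collar
    have h1 : IntegrableOn (fun t => φ t / (1 - t i)) (cutoff D ε) := by
      have := hint (insert i T₀) subset_rfl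
      rw [hset1] at this
      refine this.congr_fun (fun t _ => ?_) (measurableSet_cutoff _ _)
      simp only [hφ_def, divProd_insert hi]
      rw [div_div, mul_comm]
    have h2 : IntegrableOn φ (cutoff (D.erase i) ε) := by
      have := hint T₀ (Finset.subset_insert i T₀)
      rwa [hset2] at this
    have hstep := setIntegral_cutoff_div_one_sub i hiD hφc hε hε1 h1 h2
    -- remaining collars
    have hih := ih (D.erase i) hT₀D (hcyl.mono (Finset.subset_insert i T₀)) (fun U hU => by
      have := hint U (hU.trans (Finset.subset_insert i T₀))
      have hset : (D.erase i \ T₀) ∪ U = (D \ insert i T₀) ∪ U := by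
        congr 1
        ext j; simp [Finset.mem_sdiff, Finset.mem_erase]; tauto
      rwa [hset])
    have hset3 : D.erase i \ T₀ = D \ insert i T₀ := by
      ext j; simp [Finset.mem_sdiff, Finset.mem_erase]; tauto
    rw [hset3] at hih
    calc ∫ t in cutoff D ε, ψ t / divProd (insert i T₀) t
        = ∫ t in cutoff D ε, φ t / (1 - t i) := by
          refine setIntegral_congr_fun (measurableSet_cutoff _ _) fun t _ => ?_
          simp only [hφ_def, divProd_insert hi]
          rw [div_div, mul_comm]
      _ = -Real.log ε * ∫ t in cutoff (D.erase i) ε, φ t := hstep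
      _ = -Real.log ε * ((-Real.log ε) ^ T₀.card * ∫ t in cutoff (D \ insert i T₀) ε, ψ t) := by
          rw [← hih]
      _ = (-Real.log ε) ^ (insert i T₀).card * ∫ t in cutoff (D \ insert i T₀) ε, ψ t := by
          rw [Finset.card_insert_of_notMem hi, pow_succ]; ring

namespace IntegralRep

/-- The CUTOFF INTEGRAL of the face `T`: the ordinary integral of the face integrand over the
thickened face piece cut off at distance `ε` below its remaining divergence faces,
`I_T(ε) = ∫_{cyl T σ ∩ {tᵢ ≤ 1 - ε, i ∈ D \ T}} g(t[T:=1])/Π_{D\T}`; for `T = ∅` this is the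
classical cutoff integral `∫_{σ ∩ {t_D ≤ 1-ε}} f`. [cite: DupontPanzerPym2026, Ex. 7.13] -/
def faceCutoffIntegral (r : IntegralRep n) (T : Finset (Fin n)) (ε : ℝ) : ℝ :=
  ∫ t in cyl T r.domain ∩ {t | ∀ i ∈ r.div \ T, t i ≤ 1 - ε}, faceIntegrand r.num r.div T t

/-- On a thickened face piece the one-sided and two-sided cutoffs of the remaining divergent
coordinates agree. [folklore] -/
theorem cyl_inter_cutoff_eq (r : IntegralRep n) (T : Finset (Fin n)) (ε : ℝ) :
    cutoff (r.div \ T) ε ∩ cyl T r.domain = cyl T r.domain ∩ {t | ∀ i ∈ r.div \ T, t i ≤ 1 - ε} := by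
  ext t
  simp only [mem_inter_iff, cutoff, mem_setOf_eq]
  constructor
  · rintro ⟨h, ht⟩
    refine ⟨ht, fun i hi => ?_⟩
    have hlt := r.lt_one_of_mem_cyl ht (Finset.mem_sdiff.1 hi).1 (Finset.mem_sdiff.1 hi).2
    have := h i hi
    rw [abs_of_pos (by linarith)] at this
    linarith
  · rintro ⟨ht, h⟩
    refine ⟨fun i hi => ?_, ht⟩
    have hlt := r.lt_one_of_mem_cyl ht (Finset.mem_sdiff.1 hi).1 (Finset.mem_sdiff.1 hi).2
    rw [abs_of_pos (by linarith)]
    linarith [h i hi]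

/-- The residue integrated over its cutoff region is the face cutoff integral. [folklore] -/
theorem setIntegral_resSys_cutoff (r : IntegralRep n) {T : Finset (Fin n)} (ε : ℝ) :
    ∫ t in cutoff (r.div \ T) ε, r.resSys T t = r.faceCutoffIntegral T ε := by
  rw [resSys_apply, setIntegral_indicator (Literature.ModelTheory.ExponentialFields.IsSemialgebraic.measurableSet_holds
    (isSemialgebraic_cyl T r.isSemialgebraic_domain)), cyl_inter_cutoff_eq]
  rfl

/-- **The face term factorises**: `∫_{cutoff D ε} ρ_T/Π_T = (-log ε)^{|T|} · I_T(ε)` for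
`0 < ε ≤ 1`. [folklore] -/
theorem setIntegral_resSys_div_cutoff (r : IntegralRep n) {T : Finset (Fin n)} (hT : T ⊆ r.div)
    {ε : ℝ} (hε : 0 < ε) (hε1 : ε ≤ 1) :
    ∫ t in cutoff r.div ε, r.resSys T t / divProd T t =
      (-Real.log ε) ^ T.card * r.faceCutoffIntegral T ε := by
  rw [← setIntegral_resSys_cutoff]
  refine setIntegral_cutoff_div_divProd hε hε1 T r.div hT (r.isCylindrical_resSys T) fun U hU => ?_
  -- `ρ_T / Π_U` is integrable on `cutoff ((D \ T) ∪ U) ε` for `U ⊆ T`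
  have h1 : IntegrableOn (r.resSys T) (cutoff ((r.div \ T) ∪ U) ε) :=
    (r.isResidueSystem.integrableOn_cutoff hT hε).mono_set (cutoff_mono Finset.subset_union_left ε)
  have h2 : IntegrableOn (fun t => (divProd U t)⁻¹ * r.resSys T t) (cutoff ((r.div \ T) ∪ U) ε) := by
    refine Integrable.bdd_mul (c := (ε ^ U.card)⁻¹) h1
      (measurable_divProd U).inv.aestronglyMeasurable
      (ae_restrict_of_forall_mem (measurableSet_cutoff _ _) fun t ht => ?_)
    rw [Real.norm_eq_abs]
    exact abs_inv_divProd_le Finset.subset_union_right hε ht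
  refine h2.congr_fun (fun t _ => ?_) (measurableSet_cutoff _ _)
  rw [div_eq_inv_mul]

/-- **The cutoff expansion of the regularised value** (the classical picture of
Dupont–Panzer–Pym's Ex. 7.13 / Ex. 5.16, "subtract the divergent powers of `log ε` and let
`ε → 0`", with EXPLICIT counterterms): along `ε_k = 1/(k+1) → 0`,
`value r = lim_k ∑_{T ⊆ D} (log ε_k)^{|T|} · I_T(ε_k)`, where `I_∅(ε) = ∫_{σ ∩ {t_D ≤ 1-ε}} f` is the
cutoff integral and the `T ≠ ∅` terms are `(log ε)^{|T|}` times the cutoff integrals of the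
residues over the faces. [cite: DupontPanzerPym2026, Ex. 7.13 and Ex. 5.16] -/
theorem tendsto_cutoffExpansion (r : IntegralRep n) :
    Tendsto (fun k : ℕ => ∑ T ∈ r.div.powerset,
      Real.log (1 / ((k : ℝ) + 1)) ^ T.card * r.faceCutoffIntegral T (1 / ((k : ℝ) + 1))) atTop
      (𝓝 r.value) := by
  refine r.tendsto_setIntegral_cutoff.congr fun k => ?_
  have hε : (0 : ℝ) < 1 / ((k : ℝ) + 1) := by positivity
  have hε1 : 1 / ((k : ℝ) + 1) ≤ 1 := by
    rw [div_le_one (by positivity)]; linarith [k.cast_nonneg (α := ℝ)]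
  rw [r.setIntegral_subIntegrand_cutoff hε]
  refine Finset.sum_congr rfl fun T hT => ?_
  rw [r.setIntegral_resSys_div_cutoff (Finset.mem_powerset.1 hT) hε hε1, ← mul_assoc, ← mul_pow]
  congr 2
  ring

end IntegralRep

end KZreg

end Literature.NumberTheory.Transcendental
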